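import Literature.Barriers.Parity.FriedlanderGranvilleUniformityLemmas
import HarnessLib

/-!
# Proof of the Friedlander–Granville uniformity theorem (`FriedlanderGranvilleUniformityBarrier`)

Topic `Literature/Barriers/Parity`. This file DISCHARGES the named fact
`Literature.Barriers.Parity.FriedlanderGranvilleUniformityBarrier` of
`FriedlanderGranvilleUniformity.lean` (Friedlander–Granville, *Limitations to the
equi-distribution of primes III*, Compositio Math. 81 (1992), Theorem p. 20) as
`FriedlanderGranvilleUniformityBarrier_holds`. Everything here is PROVED.

## The argument

We follow §5 of the source (Maier's matrix method for the matrix `a + rq`, `q ≡ a (mod P)`,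
`Q < q ≤ 2Q`, `1 ≤ r ≤ y ≍ log^N Q`; files `FriedlanderGranvilleUniformityMatrix.lean`,
`…Tools.lean`) with the following changes of PARAMETERS, forced by the inputs available in the
tree and harmless for the statement (whose constants `γ_N, δ_N, Q_N` are existential):

* the sieving modulus `P = ∏_{U ∪ S} p` (small primes `U` = primes `≤ C₀ log L` not dividing `a`,
  window primes `S ⊆ (L^c, L^{b'}]` not dividing `a`, `L = log Q`, `b' < 1/5`) has
  `log P ≤ 2 L^{b'}` (instead of the source's `z = log Q/(log log Q)²`), so that the prime number
  theorem for the column moduli `rP` is the tree's Page-type theorem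
  `PageUniformPNT.chebyshevPsiMod_uniform_conductor` (range `log q ≤ (log x)^{1/5}`) instead of
  Gallagher's; this only increases the number `≍ Q/P` of moduli produced;
* the oscillation of the sieve (source: Proposition 1, Buchstab's `ω(M) ≠ e^{−γ}`) is produced by
  the window–parity device of `ShiftedWindowSieve.lean` (parity of `k` with
  `N/(k+1) < c < b' < N/k`: even `k` for the excess (1.5), odd `k` for the deficit (1.6)), the
  prime factors of `a` below `L^{2γ}` and the primes of `U` being sifted by the Fundamental Lemma;
  the hypothesis `ω(a) < (log Q)^γ` bounds the primes of `a` above `L^{2γ}`;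
* the bad moduli (source: Proposition 2) are controlled by the exceptional CONDUCTOR `d` of
  `PageUniformPNTConductor.lean` (Landau–Page) and Siegel's bound `d ≥ (log X)^A`:
  for (1.5) (`exceptional_split`, `core15`) either `d/(d, P) ≥ L^{A/2}` or a prime
  `p₁ > (A/4) log L` of `(d, P)` is removed from the window, and the bad columns `K ∣ r` are
  discarded from the lower bound; for (1.6) (`exceptional_nobad`, `core16`, the Remark after
  Proposition 2 in the source) at most `R = R(N)` window primes are removed so that NO column
  modulus is bad.

Structure: conditions on `L` (`facts_*`, elementary asymptotics), the deterministic cores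
`core15_at` / `core16_at` (the two-sided matrix count with all analytic inputs as hypotheses),
the wrappers `core15_main`/`core15` and `core16_main`/`core16` (choice of all parameters,
verification of the hypotheses for `Q > Q_N`), and the discharge
`Literature.Barriers.Parity.FriedlanderGranvilleUniformityBarrier_holds`.

## References

* J. Friedlander, A. Granville, Compositio Math. 81 (1992), 19–32: Theorem p. 20, §§3–5
  (`FriedlanderGranville1992`).
* K. Soundararajan, *The distribution of prime numbers* (2007), Lecture 3 (`Soundararajan2007Distribution`).
* H. L. Montgomery, R. C. Vaughan, *Multiplicative Number Theory I* (2007), §11 (`MontgomeryVaughan2007`).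
-/

noncomputable section

open Finset Filter Real
open scoped ArithmeticFunction.omega

namespace Literature.Barriers.Parity.FriedlanderGranville

open Literature.NumberTheory.Sieve Literature.NumberTheory.Sieve.MaierMatrix
open Literature.NumberTheory.Sieve.ShiftedWindowSieve

/-! ## The proof of (1.5) -/

set_option maxHeartbeats 6000000 in
/-- **The proof of (1.5) at a given large `Q`**: the deterministic core `core15_at` with the
parameters of the source (modified as described in the module docstring), all conditions on
`L = log Q` entering as hypotheses (`f1`–`f17`, `g1`–`g9`). [cite: FriedlanderGranville1992, §5] -/
theorem core15_main
    {C_B : ℝ} (hCB : ∀ (T U S : Finset ℕ) (z w : ℝ) (y k : ℕ) (D : ℝ),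
      (∀ p ∈ T, p.Prime) → (∀ p ∈ U, p.Prime) → (∀ p ∈ S, p.Prime) →
      (∀ p ∈ T, (p : ℝ) < z) → (∀ p ∈ U, (p : ℝ) < z) → (∀ p ∈ S, z ≤ (p : ℝ)) →
      (∀ p ∈ T, p ∉ U) → 1 ≤ w → (∀ p ∈ S, w < p) → ((y : ℝ) + 1 ≤ w ^ (k + 1)) →
      2 ≤ z → z ≤ D → Even k →
        y * sieveDensity (T ∪ U) * sieveDensity S * (1 + eSymm S (k + 1)) -
            (C_B * Real.exp (-(Real.log D / Real.log z)) * y * sieveDensity (T ∪ U) *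
                ∏ p ∈ S, (1 + (p : ℝ)⁻¹) + (k + 1) * (#S + 1) ^ k * D) ≤
          shiftedSiftedCount y T (U ∪ S))
    {C_F : ℝ} (hCF : ∀ (Ps : Finset ℕ) (z : ℝ), (∀ p ∈ Ps, p.Prime) → (∀ p ∈ Ps, (p : ℝ) < z) →
      ∀ (e : ℕ), 0 < e → (∀ p ∈ Ps, ¬ p ∣ e) → ∀ (X₁ y c : ℕ) (D : ℝ), 2 ≤ z → z ≤ D →
        |(apSiftedCount X₁ y e c Ps : ℝ) - (y : ℝ) / e * sieveDensity Ps| ≤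
          C_F * ((y : ℝ) / e) * sieveDensity Ps * Real.exp (-(Real.log D / Real.log z)) + D)
    (hC_B0 : 0 < C_B) (hC_F0 : 0 < C_F)
    {N c b' ℓ η ε θ₁ γ C₀ A V₁c e5 x₀ L Q : ℝ} {k : ℕ} {a : ℤ}
    (hN : 2 < N) (hcb' : c < b') (hck : N < c * (k + 1)) (hℓ0 : 0 < ℓ) (hℓ7 : ℓ < 7 / 10)
    (hη0 : 0 < η) (hη1 : η ≤ 1) (hηdef : η = (ℓ / 2) ^ (k + 1) / (k + 1).factorial)
    (hεdef : ε = η / 20000) (hθ₁0 : 0 < θ₁) (hγ0 : 0 < γ) (hC₀0 : 0 < C₀)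
    (hηC₀ : η * C₀ = 5000 * γ * e5 + 2 * η) (hA0 : 0 < A) (hηA : η * A = 4 * η * C₀ + 300000 * γ * e5 + 8 * η)
    (hAC₀ : C₀ ≤ A / 4) (hV₁c : V₁c = 3 * γ * e5) (he5 : e5 = Real.exp 5) (hkeven : Even k)
    (hkeyB : C_B * Real.exp (-(θ₁ / (3 * γ))) * Real.exp 1 ≤ η / 20000)
    (hx₀ : ∀ x : ℝ, x₀ ≤ x → |(Nat.primeCounting ⌊x⌋₊ : ℝ) - x / Real.log x| ≤ ε * (x / Real.log x))
    (hPage : ∃ d : ℕ, (d = 0 ∨ Real.log (Q / L ^ 2) ^ A ≤ d) ∧ ∀ q : ℕ, 1 ≤ q →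
      Real.log q ≤ Real.log (Q / L ^ 2) ^ (1 / 5 : ℝ) → ¬ d ∣ q → ∀ u : (ZMod q)ˣ, ∀ x : ℝ, Q / L ^ 2 ≤ x →
        |ParityWave0.chebyshevPsiMod q u x - x / q.totient| ≤ ε * (x / q.totient))
    -- the conditions on `L`
    (f1 : |Literature.NumberTheory.LFunctions.Mertens.primeRecipSum (L ^ b') -
        Literature.NumberTheory.LFunctions.Mertens.primeRecipSum (L ^ c) - ℓ| ≤ ℓ / 8)
    (f2 : 2 * (k + 3) / ℓ ≤ L ^ c ∧ 16 / ℓ ≤ L ^ c ∧ 4 * k / ℓ ≤ L ^ c ∧ 1 ≤ L ^ c)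
    (f3 : L ^ γ + 3 ≤ ℓ / 16 * L ^ c)
    (f4a : 2 ≤ C₀ * Real.log L) (f4b : C₀ * Real.log L ≤ L ^ (2 * γ)) (f4c : L ^ (2 * γ) + 2 ≤ L ^ (3 * γ))
    (f4d : L ^ (2 * γ) + 1 ≤ L ^ c) (f4e : L ^ (2 * γ) + 1 ≤ L ^ θ₁) (f4f : L ^ (2 * γ) + 1 ≤ Real.exp (L / 2))
    (g1 : 4 ≤ L ^ N) (g2 : A / 4 * Real.log L ≤ L ^ (A / 2)) (g4 : 2 ≤ Q / L ^ 2) (g5 : Q / L ^ 2 + 2 ≤ Q)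
    (g6 : x₀ ≤ Q) (g7 : 4 ≤ L) (g8 : L ^ c ≤ L ^ b') (g9 : 3 * L ^ N ≤ Real.exp (L / 4))
    (f5 : (L ^ (A / 2) + 1) * (4 : ℝ) ^ (A / 4 * Real.log L) < (L - 2 * Real.log L) ^ A)
    (f6 : N * Real.log L + Real.log 4 * (L ^ b' + 1) ≤ (L - 2 * Real.log L) ^ (1 / 5 : ℝ))
    (f7 : (k + 1) * (L ^ b' + 2) ^ k * L ^ θ₁ * (V₁c * Real.log L) * (20000 / η) ≤ L ^ N - 2)
    (f8 : 20000 * V₁c * Real.log L * L ^ γ ≤ η * L ^ (2 * γ))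
    (f9 : 2 * (Q / L ^ 2 + 1) ≤ η / 300 * (Q - 1))
    (f10 : 2 * Real.exp (5 * L / 8) * (2 * L) * (4 : ℝ) ^ (L ^ b' + 1) ≤ η / 300 * (Q - 1))
    (f11 : (L + Real.log 3 + N * Real.log L) * (L + Real.log 2) ^ (N - 1) ≤ (1 + η / 100) * (L ^ N - 2))
    (f11b : Real.log 3 + N * Real.log L ≤ L)
    (f12 : C_F * Real.exp (-(L / 2 / (3 * γ * Real.log L))) ≤ η / 400)
    (f13 : 400 * V₁c * Real.log L * Real.exp (L / 2) * (4 : ℝ) ^ (L ^ b' + 1) ≤ η * (Q - 1))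
    (f14 : Real.exp 5 * (L + 1) * (4 : ℝ) ^ (L ^ b' + 1) * (V₁c * Real.log L) * 400 ≤ η * (Q - 1))
    (f15 : 2 * L * (V₁c * Real.log L) * 300 ≤ η * (L ^ N - 2))
    (f16 : 2 * L * (4 : ℝ) ^ (L ^ b' + 1) * (V₁c * Real.log L) * 300 ≤ η * ((L ^ N - 2) * (Q - 1)))
    (f17 : 2 * L * Real.exp (L - L / Real.log L) * (4 : ℝ) ^ (L ^ b' + 1) * (V₁c * Real.log L) * 300 ≤
      η * (Q - 1))
    -- `Q` and `a`
    (hQ0 : 0 < Q) (hQL : Real.exp L = Q) (ha0 : a ≠ 0) (haQ : |(a : ℝ)| ≤ Q)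
    (hωR : (a.natAbs.primeFactors.card : ℝ) ≤ L ^ γ) :
    Q ^ (1 - 1 / Real.log L) ≤
      (#((Icc 1 ⌊2 * Q⌋₊).filter fun q : ℕ =>
          Q < (q : ℝ) ∧ Int.gcd (q : ℤ) a = 1 ∧
            (1 + η / 20) * ((Nat.primeCounting ⌊(q : ℝ) * Real.log q ^ N⌋₊ : ℝ) / (Nat.totient q : ℝ)) <
              (primeCountingModInt q a ((q : ℝ) * Real.log q ^ N) : ℝ)) : ℝ) := by
  classical
  have hN0 : 0 < N := by linarith only [hN]
  have hN1 : 1 ≤ N := by linarith only [hN]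
  have hLQ : Real.log Q = L := by rw [← hQL, Real.log_exp]
  have hε0 : 0 < ε := by rw [hεdef]; positivity
  have hεη : ε ≤ η / 100 := by rw [hεdef]; linarith only [hη0]
  have he50 : 0 < e5 := by rw [he5]; exact Real.exp_pos 5
  have hV₁c0 : 0 < V₁c := by rw [hV₁c]; positivity
  have hL1 : 1 ≤ L := by linarith only [g7]
  have hL0 : 0 < L := by linarith only [g7]
  have hlogL : 0 < Real.log L := Real.log_pos (by linarith only [g7])
  have h2e : (2 : ℝ) ≤ Real.exp 1 := by linarith only [Real.add_one_le_exp (1 : ℝ)]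
  have hQ16 : 16 ≤ Q := by
    rw [← hQL]
    have h1 : Real.exp 4 ≤ Real.exp L := Real.exp_le_exp.2 g7
    have h2 : Real.exp 4 = Real.exp 1 ^ 4 := by rw [← Real.exp_nat_mul]; norm_num
    have h3 : (2 : ℝ) ^ 4 ≤ Real.exp 1 ^ 4 := pow_le_pow_left₀ (by norm_num) h2e 4
    calc (16 : ℝ) = 2 ^ 4 := by norm_num
      _ ≤ Real.exp 1 ^ 4 := h3
      _ = Real.exp 4 := h2.symm
      _ ≤ Real.exp L := h1
  have hQ4 : 4 ≤ Q := by linarith only [hQ16]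
  obtain ⟨hQ12, hQ₁le, hQ₁lt, hQ₂le, hQ₂lt, hQ₂2⟩ := Qfloor_facts hQ4
  obtain ⟨hy1, hy_le, hy_ge, hy_le'⟩ := yv_facts g1
  have hy0 : (0 : ℝ) ≤ ((⌊L ^ N⌋₊ - 1 : ℕ) : ℝ) := Nat.cast_nonneg _
  have hQL2 : 0 ≤ Q / L ^ 2 := by positivity
  have hXge : Q / L ^ 2 ≤ (⌈Q / L ^ 2⌉₊ : ℝ) := Nat.le_ceil _
  have hXlt : ((⌈Q / L ^ 2⌉₊ : ℕ) : ℝ) < Q / L ^ 2 + 1 := Nat.ceil_lt_add_one hQL2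
  have hwT0 : 0 < L ^ (2 * γ) := Real.rpow_pos_of_pos hL0 _
  have hwT1 : 1 ≤ L ^ (2 * γ) := Real.one_le_rpow hL1 (by positivity)
  have hnT1 : 1 ≤ ⌊L ^ (2 * γ)⌋₊ := Nat.le_floor (by simpa using hwT1)
  have hnTle : (⌊L ^ (2 * γ)⌋₊ : ℝ) ≤ L ^ (2 * γ) := Nat.floor_le hwT0.le
  have hm₀n : ⌊C₀ * Real.log L⌋₊ ≤ ⌊L ^ (2 * γ)⌋₊ := Nat.floor_mono f4b
  have hm₀le : (⌊C₀ * Real.log L⌋₊ : ℝ) ≤ C₀ * Real.log L := Nat.floor_le (by positivity)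
  have hm₀1 : 1 ≤ ⌊C₀ * Real.log L⌋₊ := Nat.le_floor (by push_cast; linarith only [f4a])
  have hm₀nR : (⌊C₀ * Real.log L⌋₊ : ℝ) ≤ ⌊L ^ (2 * γ)⌋₊ := by exact_mod_cast hm₀n
  -- the sets of primes
  obtain ⟨T, hTdef⟩ : ∃ T : Finset ℕ, T = (Nat.primesLE ⌊L ^ (2 * γ)⌋₊).filter (fun p ↦ p ∣ a.natAbs) := ⟨_, rfl⟩
  obtain ⟨U, hUdef⟩ : ∃ U : Finset ℕ, U = (Nat.primesLE ⌊C₀ * Real.log L⌋₊).filter (fun p ↦ ¬ p ∣ a.natAbs) :=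
    ⟨_, rfl⟩
  obtain ⟨S₀, hS₀def⟩ : ∃ S₀ : Finset ℕ,
      S₀ = (Nat.primesLE ⌊L ^ b'⌋₊ \ Nat.primesLE ⌊L ^ c⌋₊).filter (fun p ↦ ¬ p ∣ a.natAbs) := ⟨_, rfl⟩
  have hT : ∀ p ∈ T, p.Prime ∧ p ∣ a.natAbs := fun p hp ↦ by
    rw [hTdef, mem_filter] at hp; exact ⟨Nat.prime_of_mem_primesLE hp.1, hp.2⟩
  have hTp : ∀ p ∈ T, p.Prime := fun p hp ↦ (hT p hp).1
  have hTn : ∀ p ∈ T, p ≤ ⌊L ^ (2 * γ)⌋₊ := fun p hp ↦ by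
    rw [hTdef, mem_filter] at hp; exact (Nat.mem_primesLE.1 hp.1).1
  have hU : ∀ p ∈ U, p.Prime := fun p hp ↦ by rw [hUdef, mem_filter] at hp; exact Nat.prime_of_mem_primesLE hp.1
  have hUa : ∀ p ∈ U, ¬ p ∣ a.natAbs := fun p hp ↦ by rw [hUdef, mem_filter] at hp; exact hp.2
  have hUm : ∀ p ∈ U, p ≤ ⌊C₀ * Real.log L⌋₊ := fun p hp ↦ by
    rw [hUdef, mem_filter] at hp; exact (Nat.mem_primesLE.1 hp.1).1
  have hS₀ : ∀ p ∈ S₀, p.Prime := fun p hp ↦ by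
    rw [hS₀def, mem_filter] at hp; exact Nat.prime_of_mem_primesLE (mem_sdiff.1 hp.1).1
  have hS₀a : ∀ p ∈ S₀, ¬ p ∣ a.natAbs := fun p hp ↦ by rw [hS₀def, mem_filter] at hp; exact hp.2
  have hS₀W : S₀ ⊆ Nat.primesLE ⌊L ^ b'⌋₊ \ Nat.primesLE ⌊L ^ c⌋₊ := by rw [hS₀def]; exact filter_subset _ _
  have hTU : ∀ p ∈ T ∪ U, p.Prime := fun p hp ↦ (mem_union.1 hp).elim (hTp p) (hU p)
  -- Page's theorem at `X_A = Q/L²` and the exceptional conductor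
  obtain ⟨d, hdsize, hdPNT⟩ := hPage
  have hUK : ∀ p ∈ U, (p : ℝ) ≤ A / 4 * Real.log L := by
    intro p hp
    have : (p : ℝ) ≤ ⌊C₀ * Real.log L⌋₊ := by exact_mod_cast hUm p hp
    exact this.trans (hm₀le.trans (mul_le_mul_of_nonneg_right hAC₀ hlogL.le))
  have hdsplit : d = 0 ∨ (⌈L ^ (A / 2)⌉₊ : ℝ) * 4 ^ ⌊A / 4 * Real.log L⌋₊ < d :=
    split_hyp hL1 hA0 f5 (by rwa [hQL])
  obtain ⟨K, S, hSS₀, hScard, hKprop, hgood⟩ := exceptional_split U S₀ hU hS₀ hUK ⌈L ^ (A / 2)⌉₊ d hdsplit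
  -- the window facts for `S`
  have hSW : S ⊆ Nat.primesLE ⌊L ^ b'⌋₊ \ Nat.primesLE ⌊L ^ c⌋₊ := hSS₀.trans hS₀W
  have hωcard : a.natAbs.primeFactors.card ≤ ⌊L ^ γ⌋₊ := Nat.le_floor hωR
  have hRcount : #(Nat.primesLE ⌊L ^ b'⌋₊ \ Nat.primesLE ⌊L ^ c⌋₊) ≤ #S + (⌊L ^ γ⌋₊ + 2) := by
    have h1 := Finset.card_filter_add_card_filter_not (s := Nat.primesLE ⌊L ^ b'⌋₊ \ Nat.primesLE ⌊L ^ c⌋₊)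
      (fun p ↦ ¬ p ∣ a.natAbs)
    rw [← hS₀def] at h1
    have h2 : #((Nat.primesLE ⌊L ^ b'⌋₊ \ Nat.primesLE ⌊L ^ c⌋₊).filter fun p ↦ ¬¬ p ∣ a.natAbs) ≤
        a.natAbs.primeFactors.card := by
      refine card_le_card fun p hp ↦ ?_
      rw [mem_filter, not_not] at hp
      exact Nat.mem_primeFactors.2 ⟨Nat.prime_of_mem_primesLE (mem_sdiff.1 hp.1).1, hp.2, Int.natAbs_ne_zero.2 ha0⟩
    omega
  have hRc : (((⌊L ^ γ⌋₊ + 2 : ℕ)) : ℝ) / L ^ c ≤ ℓ / 16 := by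
    have hLc0 : 0 < L ^ c := Real.rpow_pos_of_pos hL0 c
    rw [div_le_iff₀ hLc0]
    have : (⌊L ^ γ⌋₊ : ℝ) ≤ L ^ γ := Nat.floor_le (Real.rpow_nonneg hL0.le _)
    push_cast; linarith only [this, f3]
  obtain ⟨heS, hW5, hSsum, -, hScardR, hSprops⟩ := window_facts hcb' hL1 hℓ0 hℓ7 f1 f2 hRc hSW hRcount
  have heS' : η ≤ eSymm S (k + 1) := by rw [hηdef]; exact heS
  have hS : ∀ p ∈ S, p.Prime := fun p hp ↦ (hSprops p hp).1
  have hSa : ∀ p ∈ S, ¬ p ∣ a.natAbs := fun p hp ↦ hS₀a p (hSS₀ hp)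
  have hSgt : ∀ p ∈ S, L ^ c < p := fun p hp ↦ (hSprops p hp).2.1
  have hSle : ∀ p ∈ S, (p : ℝ) ≤ L ^ b' := fun p hp ↦ (hSprops p hp).2.2
  have hUS : ∀ p ∈ U ∪ S, p.Prime := fun p hp ↦ (mem_union.1 hp).elim (hU p) (hS p)
  have hUSa : ∀ p ∈ U ∪ S, ¬ p ∣ a.natAbs := fun p hp ↦ (mem_union.1 hp).elim (hUa p) (hSa p)
  have hP0 : 0 < ∏ p ∈ U ∪ S, p := prod_pos fun p hp ↦ (hUS p hp).pos
  have hP1 : 1 ≤ ∏ p ∈ U ∪ S, p := hP0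
  have hP0R : (0 : ℝ) < (∏ p ∈ U ∪ S, p : ℕ) := by exact_mod_cast hP0
  have hUSle : ∀ p ∈ U ∪ S, (p : ℝ) ≤ L ^ b' + 1 := by
    intro p hp
    rcases mem_union.1 hp with h | h
    · have : (p : ℝ) ≤ ⌊C₀ * Real.log L⌋₊ := by exact_mod_cast hUm p h
      linarith only [this, hm₀nR, hnTle, f4d, g8]
    · linarith only [hSle p h]
  have hPle : ((∏ p ∈ U ∪ S, p : ℕ) : ℝ) ≤ (4 : ℝ) ^ (L ^ b' + 1) :=
    prod_primes_le_four_rpow (by have := Real.rpow_nonneg hL0.le b'; linarith only [this]) hUS hUSle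
  have hφP : (((∏ p ∈ U ∪ S, p).totient : ℕ) : ℝ) ≤ (4 : ℝ) ^ (L ^ b' + 1) :=
    le_trans (by exact_mod_cast Nat.totient_le _) hPle
  have haP : IsCoprime a ((∏ p ∈ U ∪ S, p : ℕ) : ℤ) := isCoprime_prod_of_not_dvd hUS hUSa
  -- the densities: `V₁ = (V₁c log L)⁻¹`
  have hV₁pos : 0 < (V₁c * Real.log L)⁻¹ := by positivity
  have hzv3γ : (⌊L ^ (2 * γ)⌋₊ : ℝ) + 2 ≤ L ^ (3 * γ) := by linarith only [hnTle, f4c]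
  have hlognT : Real.log ((⌊L ^ (2 * γ)⌋₊ : ℝ) + 2) ≤ 3 * γ * Real.log L := by
    calc Real.log ((⌊L ^ (2 * γ)⌋₊ : ℝ) + 2) ≤ Real.log (L ^ (3 * γ)) := Real.log_le_log (by positivity) hzv3γ
      _ = 3 * γ * Real.log L := Real.log_rpow hL0 _
  have hV₁eq : (Real.exp 5 * (3 * γ * Real.log L))⁻¹ = (V₁c * Real.log L)⁻¹ := by rw [hV₁c, he5]; ring_nf
  have hV₁V : (V₁c * Real.log L)⁻¹ ≤ sieveDensity (T ∪ U) := by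
    rw [← hV₁eq]
    refine sieveDensity_ge_of_log_le hTU (n := ⌊L ^ (2 * γ)⌋₊) (fun p hp ↦ ?_) hlognT
    rcases mem_union.1 hp with h | h
    · exact hTn p h
    · exact (hUm p h).trans hm₀n
  have hV₁T : (V₁c * Real.log L)⁻¹ ≤ sieveDensity T := by
    rw [← hV₁eq]; exact sieveDensity_ge_of_log_le hTp (n := ⌊L ^ (2 * γ)⌋₊) hTn hlognT
  -- `Xmax = 3 L^N Q`
  obtain ⟨hlogXmax, hXmax2, hsqrtXmax, hlogXmax2⟩ := Xmax_facts hL1 hN0 g9 f11b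
  rw [hQL] at hlogXmax hXmax2 hsqrtXmax hlogXmax2
  have hlX0 : 0 ≤ Real.log (3 * L ^ N * Q) := Real.log_nonneg (by linarith only [hXmax2])
  -- ### the hypotheses of `core15_at`
  have ha_natAbs : a.natAbs ≤ ⌊Q⌋₊ := Nat.le_floor (by rw [Nat.cast_natAbs, Int.cast_abs]; exact haQ)
  have hTz : ∀ p ∈ T, (p : ℝ) < (⌊L ^ (2 * γ)⌋₊ : ℝ) + 1 := fun p hp ↦ by
    have : (p : ℝ) ≤ ⌊L ^ (2 * γ)⌋₊ := by exact_mod_cast hTn p hp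
    linarith only [this]
  have hUz : ∀ p ∈ U, (p : ℝ) < (⌊L ^ (2 * γ)⌋₊ : ℝ) + 1 := fun p hp ↦ by
    have : (p : ℝ) ≤ ⌊L ^ (2 * γ)⌋₊ := by exact_mod_cast (hUm p hp).trans hm₀n
    linarith only [this]
  have hzvc : (⌊L ^ (2 * γ)⌋₊ : ℝ) + 1 ≤ L ^ c := by linarith only [hnTle, f4d]
  have hSz : ∀ p ∈ S, (⌊L ^ (2 * γ)⌋₊ : ℝ) + 1 ≤ (p : ℝ) := fun p hp ↦ hzvc.trans (hSgt p hp).le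
  have hw : (1 : ℝ) ≤ L ^ c := f2.2.2.2
  have hyw : (((⌊L ^ N⌋₊ - 1 : ℕ)) : ℝ) + 1 ≤ (L ^ c) ^ (k + 1) := by
    have h1 : L ^ N ≤ L ^ (c * (k + 1)) := Real.rpow_le_rpow_of_exponent_le hL1 hck.le
    have h2 : (L ^ c) ^ (k + 1) = L ^ (c * (k + 1)) := by
      rw [← Real.rpow_natCast, ← Real.rpow_mul hL0.le]; push_cast; ring_nf
    rw [h2]; exact hy_le.trans h1
  have hz : 2 ≤ (⌊L ^ (2 * γ)⌋₊ : ℝ) + 1 := by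
    have : (1 : ℝ) ≤ ⌊L ^ (2 * γ)⌋₊ := by exact_mod_cast hnT1
    linarith only [this]
  have hzD : (⌊L ^ (2 * γ)⌋₊ : ℝ) + 1 ≤ L ^ θ₁ := by linarith only [hnTle, f4e]
  have hout : ∀ p : ℕ, p.Prime → p ∣ a.natAbs → p ∉ T → L ^ (2 * γ) < p := by
    intro p hp hpa hpT
    by_contra h; push Not at h
    exact hpT (by rw [hTdef]; exact mem_filter.2 ⟨Nat.mem_primesLE.2 ⟨Nat.le_floor h, hp⟩, hpa⟩)
  have hzTD : (⌊L ^ (2 * γ)⌋₊ : ℝ) + 1 ≤ Real.exp (L / 2) := by linarith only [hnTle, f4f]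
  -- the weights
  obtain ⟨Ps, hPsdef⟩ : ∃ Ps : Finset ℕ, Ps = (Nat.primesLE ⌊2 * Q⌋₊).filter (fun p ↦ ¬ p ∣ a.natAbs ∧ p ∉ U ∪ S) :=
    ⟨_, rfl⟩
  have hPs : ∀ p ∈ Ps, p.Prime := fun p hp ↦ by
    rw [hPsdef, mem_filter] at hp; exact Nat.prime_of_mem_primesLE hp.1
  have hPsm : ∀ p ∈ Ps, ⌊C₀ * Real.log L⌋₊ < p := by
    intro p hp
    rw [hPsdef, mem_filter] at hp
    obtain ⟨hp1, hp2, hp3⟩ := hp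
    by_contra h; push Not at h
    refine hp3 (mem_union_left _ ?_)
    rw [hUdef]; exact mem_filter.2 ⟨Nat.mem_primesLE.2 ⟨h, Nat.prime_of_mem_primesLE hp1⟩, hp2⟩
  have hPsP : ∀ p ∈ Ps, ¬ p ∣ ∏ p ∈ U ∪ S, p := by
    intro p hp hpP
    rw [hPsdef, mem_filter] at hp
    obtain ⟨hp1, -, hp3⟩ := hp
    have hpp := Nat.prime_of_mem_primesLE hp1
    rw [(Nat.prime_iff.1 hpp).dvd_finsetProd_iff] at hpP
    obtain ⟨q, hq, hpq⟩ := hpP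
    have : p = q := (Nat.prime_dvd_prime_iff_eq hpp (hUS q hq)).1 hpq
    subst this
    exact hp3 hq
  have hfac : ∀ q ∈ (moduliSet ⌊Q⌋₊ ⌊2 * Q⌋₊ (∏ p ∈ U ∪ S, p) a).filter (fun q : ℕ ↦ Int.gcd (q : ℤ) a = 1),
      q.primeFactors ⊆ Ps := by
    intro q hq p hp
    obtain ⟨hqD, hgcd⟩ := mem_filter.1 hq
    obtain ⟨⟨-, hqQ₂⟩, hmod⟩ := mem_moduliSet.1 hqD
    obtain ⟨hpa, hpR⟩ := primeFactors_avoid (R := U ∪ S) hmod hgcd p hp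
    rw [hPsdef]
    exact mem_filter.2 ⟨Nat.mem_primesLE.2 ⟨(Nat.le_of_mem_primeFactors hp).trans hqQ₂,
      Nat.prime_of_mem_primeFactors hp⟩, hpa, hpR⟩
  -- the columns
  have hX2 : 2 ≤ ⌈Q / L ^ 2⌉₊ := by
    have : (2 : ℝ) ≤ ⌈Q / L ^ 2⌉₊ := le_trans g4 hXge
    exact_mod_cast this
  have haQ' := abs_le.1 haQ
  have hXQ : ((⌈Q / L ^ 2⌉₊ : ℕ) : ℝ) ≤ (a : ℝ) + (⌊2 * Q⌋₊ : ℕ) := by linarith only [hXlt, g5, haQ'.1, hQ₂lt]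
  have hLN1 : 1 ≤ L ^ N := Real.one_le_rpow hL1 hN0.le
  have hXmaxb : (a : ℝ) + ((⌊L ^ N⌋₊ - 1 : ℕ) : ℝ) * (⌊2 * Q⌋₊ : ℕ) ≤ 3 * L ^ N * Q := by
    have h1 : (((⌊L ^ N⌋₊ - 1 : ℕ)) : ℝ) * (⌊2 * Q⌋₊ : ℕ) ≤ L ^ N * (2 * Q) :=
      mul_le_mul hy_le' hQ₂le (Nat.cast_nonneg _) (by linarith only [hLN1])
    have h2 : Q ≤ L ^ N * Q := le_mul_of_one_le_left hQ0.le hLN1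
    linarith only [haQ'.2, h1, h2]
  have hψ := pnt_good_columns (K := K) hP1 haP hdPNT
    (by have := pnt_range (N := N) hL1 hP1 hPle hy_le' f6; rwa [hQL] at this) hgood hXge
  -- the rows
  have hq_gt : ∀ q ∈ moduliSet ⌊Q⌋₊ ⌊2 * Q⌋₊ (∏ p ∈ U ∪ S, p) a, Q < q ∧ L ≤ Real.log q := by
    intro q hq
    obtain ⟨⟨hq1, -⟩, -⟩ := mem_moduliSet.1 hq
    have h1 : (⌊Q⌋₊ : ℝ) + 1 ≤ q := by exact_mod_cast hq1
    have h2 : Q < q := by linarith only [h1, hQ₁lt]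
    exact ⟨h2, by rw [← hLQ]; exact Real.log_le_log hQ0 h2.le⟩
  have hyq : ∀ q ∈ moduliSet ⌊Q⌋₊ ⌊2 * Q⌋₊ (∏ p ∈ U ∪ S, p) a,
      (a : ℝ) + ((⌊L ^ N⌋₊ - 1 : ℕ) : ℝ) * q ≤ q * Real.log q ^ N := by
    intro q hq
    obtain ⟨h1, h2⟩ := hq_gt q hq
    have hq0 : (0 : ℝ) ≤ q := Nat.cast_nonneg q
    have h3 : L ^ N ≤ Real.log q ^ N := Real.rpow_le_rpow hL0.le h2 hN0.le
    have h4 : ((((⌊L ^ N⌋₊ - 1 : ℕ)) : ℝ) + 1) * q ≤ Real.log q ^ N * q :=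
      mul_le_mul_of_nonneg_right (by linarith only [hy_le, h3]) hq0
    have h5 : (a : ℝ) ≤ Q := haQ'.2
    nlinarith only [h4, h5, h1]
  have hπ : ∀ x : ℝ, x₀ ≤ x → (Nat.primeCounting ⌊x⌋₊ : ℝ) ≤ (1 + ε) * (x / Real.log x) := by
    intro x hx; have := (abs_le.1 (hx₀ x hx)).2; linarith only [this]
  have hlogq : ∀ q ∈ moduliSet ⌊Q⌋₊ ⌊2 * Q⌋₊ (∏ p ∈ U ∪ S, p) a, 1 ≤ Real.log q :=
    fun q hq ↦ hL1.trans (hq_gt q hq).2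
  have hx₀q : ∀ q ∈ moduliSet ⌊Q⌋₊ ⌊2 * Q⌋₊ (∏ p ∈ U ∪ S, p) a, x₀ ≤ (q : ℝ) * Real.log q ^ N := by
    intro q hq
    obtain ⟨h1, h2⟩ := hq_gt q hq
    have h3 : 1 ≤ Real.log q ^ N := Real.one_le_rpow (hL1.trans h2) hN0.le
    have h4 : (q : ℝ) ≤ q * Real.log q ^ N := le_mul_of_one_le_right (Nat.cast_nonneg q) h3
    linarith only [g6, h1, h4]
  -- ### smallness `hs1`
  have hlogzv0 : 0 < Real.log ((⌊L ^ (2 * γ)⌋₊ : ℝ) + 1) := Real.log_pos (by linarith only [hz])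
  have hlogzv : Real.log ((⌊L ^ (2 * γ)⌋₊ : ℝ) + 1) ≤ 3 * γ * Real.log L := by
    calc Real.log ((⌊L ^ (2 * γ)⌋₊ : ℝ) + 1) ≤ Real.log (L ^ (3 * γ)) :=
          Real.log_le_log (by linarith only [hz]) (by linarith only [hzv3γ])
      _ = 3 * γ * Real.log L := Real.log_rpow hL0 _
  have hEx : Real.exp (-(Real.log (L ^ θ₁) / Real.log ((⌊L ^ (2 * γ)⌋₊ : ℝ) + 1))) ≤ Real.exp (-(θ₁ / (3 * γ))) := by
    rw [Real.exp_le_exp, neg_le_neg_iff, Real.log_rpow hL0]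
    calc θ₁ / (3 * γ) = θ₁ * Real.log L / (3 * γ * Real.log L) := by field_simp
      _ ≤ θ₁ * Real.log L / Real.log ((⌊L ^ (2 * γ)⌋₊ : ℝ) + 1) :=
          div_le_div_of_nonneg_left (by positivity) hlogzv0 hlogzv
  have hPi0 : 0 ≤ ∏ p ∈ S, (1 + (p : ℝ)⁻¹) := prod_nonneg fun p _ ↦ by positivity
  have hPi : ∏ p ∈ S, (1 + (p : ℝ)⁻¹) ≤ Real.exp 1 := (prod_one_add_inv_le_exp S).trans (Real.exp_le_exp.2 hSsum)
  have hA' : 80000 * V₁c ≤ η * A := by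
    rw [hV₁c, hηA]; linarith only [mul_pos hη0 hC₀0, mul_pos hγ0 he50, hη0]
  have hKalt : K = 0 ∨ A / 4 * Real.log L ≤ (K : ℝ) := by
    rcases hKprop with hK0 | hK₀ | ⟨-, hK₁K, -, -⟩
    · exact Or.inl hK0
    · refine Or.inr (le_trans ?_ (show ((⌈L ^ (A / 2)⌉₊ : ℕ) : ℝ) ≤ K by exact_mod_cast hK₀))
      exact g2.trans (Nat.le_ceil _)
    · exact Or.inr hK₁K.le
  obtain ⟨hT2, hT3, hT4⟩ := hs1_terms (cS := (#S : ℝ)) (om := (a.natAbs.primeFactors.card : ℝ))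
    (y := (((⌊L ^ N⌋₊ - 1 : ℕ)) : ℝ)) hL0 hη0 hV₁c0 hlogL hA0 (Nat.cast_nonneg _) hScardR f7 hωR f8 hy0 hA' hKalt
  have hs1 := hs1_of (Sk := (k + 1) * ((#S : ℝ) + 1) ^ k * L ^ θ₁) hC_B0.le (Real.exp_pos _).le hEx hkeyB
    hPi0 hPi hy0 hy_ge hV₁pos.le hV₁V hW5 hη0.le hT2 hT3 hT4
  -- ### smallness `hs2`
  have hΔ : Q - 1 ≤ ((⌊2 * Q⌋₊ : ℕ) : ℝ) - (⌊Q⌋₊ : ℕ) := by linarith only [hQ₁le, hQ₂lt]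
  have hs2 := hs2_of (S₁ := 3 * L ^ N * Q) (lX := Real.log (3 * L ^ N * Q)) hεdef hη0.le hL0.le hQ16 hQ₁le hQ₂le hΔ
    hXlt.le (Nat.cast_nonneg _) f9 hsqrtXmax hlX0 hlogXmax2 (Nat.cast_nonneg _) hφP f10 hη1
  -- ### smallness `hs3`
  have hQ₂R : (2 : ℝ) ≤ (⌊2 * Q⌋₊ : ℕ) := by exact_mod_cast hQ₂2
  have hs3 : Real.log (3 * L ^ N * Q) * Real.log ((⌊2 * Q⌋₊ : ℕ) : ℝ) ^ (N - 1) ≤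
      (1 + η / 100) * (((⌊L ^ N⌋₊ - 1 : ℕ)) : ℝ) := by
    have hQ₂pos : (0 : ℝ) < (⌊2 * Q⌋₊ : ℕ) := by linarith only [hQ₂R]
    have e1 : Real.log ((⌊2 * Q⌋₊ : ℕ) : ℝ) ≤ L + Real.log 2 := by
      calc Real.log ((⌊2 * Q⌋₊ : ℕ) : ℝ) ≤ Real.log (2 * Q) := Real.log_le_log hQ₂pos hQ₂le
        _ = L + Real.log 2 := by rw [Real.log_mul two_ne_zero hQ0.ne', hLQ]; ring
    have e0 : 0 ≤ Real.log ((⌊2 * Q⌋₊ : ℕ) : ℝ) := Real.log_nonneg (by linarith only [hQ₂R])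
    have e2 : Real.log ((⌊2 * Q⌋₊ : ℕ) : ℝ) ^ (N - 1) ≤ (L + Real.log 2) ^ (N - 1) :=
      Real.rpow_le_rpow e0 e1 (by linarith only [hN1])
    calc Real.log (3 * L ^ N * Q) * Real.log ((⌊2 * Q⌋₊ : ℕ) : ℝ) ^ (N - 1)
        ≤ (L + Real.log 3 + N * Real.log L) * (L + Real.log 2) ^ (N - 1) := by
          rw [hlogXmax]; rw [hlogXmax] at hlX0; exact mul_le_mul_of_nonneg_left e2 hlX0
      _ ≤ (1 + η / 100) * (L ^ N - 2) := f11
      _ ≤ (1 + η / 100) * (((⌊L ^ N⌋₊ - 1 : ℕ)) : ℝ) := mul_le_mul_of_nonneg_left hy_ge (by positivity)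
  -- ### smallness `hs4`
  have hF4pos : (0 : ℝ) < (4 : ℝ) ^ (L ^ b' + 1) := Real.rpow_pos_of_pos (by norm_num) _
  have hΔP : (Q - 1) / (4 : ℝ) ^ (L ^ b' + 1) ≤ (((⌊2 * Q⌋₊ : ℕ) : ℝ) - (⌊Q⌋₊ : ℕ)) / (∏ p ∈ U ∪ S, p : ℕ) :=
    div_le_div₀ (by linarith only [hΔ, hQ16]) hΔ hP0R hPle
  have hM0 : 0 ≤ (((⌊2 * Q⌋₊ : ℕ) : ℝ) - (⌊Q⌋₊ : ℕ)) / (∏ p ∈ U ∪ S, p : ℕ) := by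
    have : 0 ≤ ((⌊2 * Q⌋₊ : ℕ) : ℝ) - (⌊Q⌋₊ : ℕ) := by linarith only [hΔ, hQ16]
    positivity
  have h4a : C_F * Real.exp (-(Real.log (Real.exp (L / 2)) / Real.log ((⌊L ^ (2 * γ)⌋₊ : ℝ) + 1))) ≤ η / 400 := by
    refine le_trans (mul_le_mul_of_nonneg_left ?_ hC_F0.le) f12
    rw [Real.log_exp, Real.exp_le_exp, neg_le_neg_iff]
    exact div_le_div_of_nonneg_left (by positivity) hlogzv0 hlogzv
  have hkey4 : ∀ Z : ℝ, 400 * V₁c * Real.log L * Z * (4 : ℝ) ^ (L ^ b' + 1) ≤ η * (Q - 1) →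
      Z ≤ η / 400 * ((((⌊2 * Q⌋₊ : ℕ) : ℝ) - (⌊Q⌋₊ : ℕ)) / (∏ p ∈ U ∪ S, p : ℕ) * (V₁c * Real.log L)⁻¹) := by
    intro Z hZ
    have e1 : Z ≤ η / 400 * ((Q - 1) / (4 : ℝ) ^ (L ^ b' + 1)) * (V₁c * Real.log L)⁻¹ := by
      have : η / 400 * ((Q - 1) / (4 : ℝ) ^ (L ^ b' + 1)) * (V₁c * Real.log L)⁻¹ =
          η * (Q - 1) / (400 * V₁c * Real.log L * (4 : ℝ) ^ (L ^ b' + 1)) := by field_simp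
      rw [this, le_div_iff₀ (by positivity)]; linarith only [hZ]
    have e2 : η / 400 * ((Q - 1) / (4 : ℝ) ^ (L ^ b' + 1)) * (V₁c * Real.log L)⁻¹ ≤
        η / 400 * ((((⌊2 * Q⌋₊ : ℕ) : ℝ) - (⌊Q⌋₊ : ℕ)) / (∏ p ∈ U ∪ S, p : ℕ) * (V₁c * Real.log L)⁻¹) := by
      rw [mul_assoc]; exact mul_le_mul_of_nonneg_left (mul_le_mul_of_nonneg_right hΔP hV₁pos.le) (by positivity)
    exact e1.trans e2
  have h4b : Real.exp (L / 2) ≤ η / 400 * ((((⌊2 * Q⌋₊ : ℕ) : ℝ) - (⌊Q⌋₊ : ℕ)) / (∏ p ∈ U ∪ S, p : ℕ) * sieveDensity T) := by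
    refine (hkey4 _ (by linarith only [f13])).trans ?_
    exact mul_le_mul_of_nonneg_left (mul_le_mul_of_nonneg_left hV₁T hM0) (by positivity)
  have h4c : Real.exp (((⌊C₀ * Real.log L⌋₊ : ℕ) : ℝ)⁻¹) - 1 ≤ η / 400 * (V₁c * Real.log L)⁻¹ := by
    have e1 := exp_inv_sub_one_le hm₀1
    have hm₀ge : C₀ * Real.log L / 2 ≤ (⌊C₀ * Real.log L⌋₊ : ℕ) := by
      have : C₀ * Real.log L < (⌊C₀ * Real.log L⌋₊ : ℕ) + 1 := Nat.lt_floor_add_one _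
      linarith only [this, f4a]
    have hm₀pos : (0 : ℝ) < (⌊C₀ * Real.log L⌋₊ : ℕ) := by exact_mod_cast hm₀1
    have e2 : 2 * ((⌊C₀ * Real.log L⌋₊ : ℕ) : ℝ)⁻¹ ≤ 4 / (C₀ * Real.log L) := by
      rw [← div_eq_mul_inv, div_le_div_iff₀ hm₀pos (by positivity)]; linarith only [hm₀ge]
    have h1600 : 1600 * V₁c ≤ η * C₀ := by
      rw [hV₁c, hηC₀]; linarith only [mul_pos hγ0 he50, hη0]
    have e3 : 4 / (C₀ * Real.log L) ≤ η / 400 * (V₁c * Real.log L)⁻¹ := by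
      have : η / 400 * (V₁c * Real.log L)⁻¹ = η * C₀ / (400 * V₁c * (C₀ * Real.log L)) := by field_simp
      rw [this, div_le_div_iff₀ (by positivity) (by positivity)]
      have hCL : 0 ≤ C₀ * Real.log L := by positivity
      calc 4 * (400 * V₁c * (C₀ * Real.log L)) = 1600 * V₁c * (C₀ * Real.log L) := by ring
        _ ≤ η * C₀ * (C₀ * Real.log L) := mul_le_mul_of_nonneg_right h1600 hCL
    linarith only [e1, e2, e3]
  have h4d : (sieveDensity Ps)⁻¹ ≤ η / 400 * ((((⌊2 * Q⌋₊ : ℕ) : ℝ) - (⌊Q⌋₊ : ℕ)) / (∏ p ∈ U ∪ S, p : ℕ) * sieveDensity T) := by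
    have e1 : Real.log (((⌊2 * Q⌋₊ : ℕ) : ℝ) + 2) ≤ L + 1 := by
      have he1 : 27 / 10 < Real.exp 1 := by have := Real.exp_one_gt_d9; linarith only [this]
      have he2 : 27 / 10 * Q ≤ Real.exp 1 * Q := mul_le_mul_of_nonneg_right he1.le hQ0.le
      calc Real.log (((⌊2 * Q⌋₊ : ℕ) : ℝ) + 2) ≤ Real.log (Real.exp 1 * Q) :=
            Real.log_le_log (by positivity) (by linarith only [he2, hQ₂le, hQ16])
        _ = L + 1 := by rw [Real.log_mul (Real.exp_pos 1).ne' hQ0.ne', Real.log_exp, hLQ]; ring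
    have e2 := sieveDensity_ge_of_log_le hPs (n := ⌊2 * Q⌋₊)
      (fun p hp ↦ by rw [hPsdef, mem_filter] at hp; exact (Nat.mem_primesLE.1 hp.1).1) e1
    have e3 : (sieveDensity Ps)⁻¹ ≤ Real.exp 5 * (L + 1) := by
      have hpos : 0 < (Real.exp 5 * (L + 1))⁻¹ := by positivity
      have := inv_anti₀ hpos e2; rwa [inv_inv] at this
    refine e3.trans ((hkey4 _ ?_).trans ?_)
    · linarith only [f14]
    · exact mul_le_mul_of_nonneg_left (mul_le_mul_of_nonneg_left hV₁T hM0) (by positivity)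
  have hs4 := hs4_of (C_F := C_F) (Ex := Real.exp (-(Real.log (Real.exp (L / 2)) / Real.log ((⌊L ^ (2 * γ)⌋₊ : ℝ) + 1))))
    (Wi := (sieveDensity Ps)⁻¹) hM0 hV₁T hV₁pos.le hη0.le h4a h4b h4c h4d
  -- ### smallness `hs5`
  have hBv0 : 0 ≤ Q ^ (1 - 1 / Real.log L) := Real.rpow_nonneg hQ0.le _
  have hBv : Q ^ (1 - 1 / Real.log L) = Real.exp (L - L / Real.log L) := by
    rw [Real.rpow_def_of_pos hQ0, hLQ]; congr 1; field_simp
  have h5a : 2 * L ≤ η / 300 * ((L ^ N - 2) * (V₁c * Real.log L)⁻¹) := by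
    have : η / 300 * ((L ^ N - 2) * (V₁c * Real.log L)⁻¹) = η * (L ^ N - 2) / (300 * V₁c * Real.log L) := by
      field_simp
    rw [this, le_div_iff₀ (by positivity)]; linarith only [f15]
  have h5b : 2 * L ≤ η / 300 * ((L ^ N - 2) * (V₁c * Real.log L)⁻¹ *
      ((((⌊2 * Q⌋₊ : ℕ) : ℝ) - (⌊Q⌋₊ : ℕ)) / (∏ p ∈ U ∪ S, p : ℕ))) := by
    have e1 : 2 * L ≤ η / 300 * ((L ^ N - 2) * (V₁c * Real.log L)⁻¹ * ((Q - 1) / (4 : ℝ) ^ (L ^ b' + 1))) := by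
      have : η / 300 * ((L ^ N - 2) * (V₁c * Real.log L)⁻¹ * ((Q - 1) / (4 : ℝ) ^ (L ^ b' + 1))) =
          η * ((L ^ N - 2) * (Q - 1)) / (300 * V₁c * Real.log L * (4 : ℝ) ^ (L ^ b' + 1)) := by field_simp
      rw [this, le_div_iff₀ (by positivity)]; linarith only [f16]
    have hLN2 : 0 ≤ L ^ N - 2 := by linarith only [g1]
    have e2 : η / 300 * ((L ^ N - 2) * (V₁c * Real.log L)⁻¹ * ((Q - 1) / (4 : ℝ) ^ (L ^ b' + 1))) ≤
        η / 300 * ((L ^ N - 2) * (V₁c * Real.log L)⁻¹ * ((((⌊2 * Q⌋₊ : ℕ) : ℝ) - (⌊Q⌋₊ : ℕ)) / (∏ p ∈ U ∪ S, p : ℕ))) :=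
      mul_le_mul_of_nonneg_left (mul_le_mul_of_nonneg_left hΔP (by positivity)) (by positivity)
    exact e1.trans e2
  have h5c : 2 * L * Q ^ (1 - 1 / Real.log L) ≤
      η / 300 * ((V₁c * Real.log L)⁻¹ * ((((⌊2 * Q⌋₊ : ℕ) : ℝ) - (⌊Q⌋₊ : ℕ)) / (∏ p ∈ U ∪ S, p : ℕ))) := by
    rw [hBv]
    have e1 : 2 * L * Real.exp (L - L / Real.log L) ≤ η / 300 * ((V₁c * Real.log L)⁻¹ * ((Q - 1) / (4 : ℝ) ^ (L ^ b' + 1))) := by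
      have : η / 300 * ((V₁c * Real.log L)⁻¹ * ((Q - 1) / (4 : ℝ) ^ (L ^ b' + 1))) =
          η * (Q - 1) / (300 * V₁c * Real.log L * (4 : ℝ) ^ (L ^ b' + 1)) := by field_simp
      rw [this, le_div_iff₀ (by positivity)]; linarith only [f17]
    have e2 : η / 300 * ((V₁c * Real.log L)⁻¹ * ((Q - 1) / (4 : ℝ) ^ (L ^ b' + 1))) ≤
        η / 300 * ((V₁c * Real.log L)⁻¹ * ((((⌊2 * Q⌋₊ : ℕ) : ℝ) - (⌊Q⌋₊ : ℕ)) / (∏ p ∈ U ∪ S, p : ℕ))) :=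
      mul_le_mul_of_nonneg_left (mul_le_mul_of_nonneg_left hΔP hV₁pos.le) (by positivity)
    exact e1.trans e2
  have hs5 := hs5_of (lX := Real.log (3 * L ^ N * Q)) (y := (((⌊L ^ N⌋₊ - 1 : ℕ)) : ℝ)) hlogXmax2 hM0 hy0 hy_ge hV₁T
    hV₁pos.le hBv0 hη0.le h5a h5b h5c
  -- ### the core, and the conclusion
  have hcore := core15_at hCB hCF (K := K) hN1 hη0 hη1 hε0.le hεη hQ12 ha_natAbs ha0 hT hU hS hUa hSa hTz hUz hSz hw
    hSgt hyw hz hzD hkeven heS' hwT0 hout hz hTz hzTD hm₀1 hPs hPsm hPsP hfac hX2 hXQ hXmaxb hXmax2 hψ hyq hπ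
    hlogq hx₀q hs1 hs2 hs3 hs4 hs5
  refine hcore.trans ?_
  exact_mod_cast card_le_card fun q hq ↦ by
    simp only [mem_filter] at hq ⊢
    obtain ⟨⟨hqD, hgcd⟩, hviol⟩ := hq
    obtain ⟨⟨hq1, hq2⟩, -⟩ := mem_moduliSet.1 hqD
    refine ⟨mem_Icc.2 ⟨by omega, hq2⟩, (hq_gt q hqD).1, hgcd, hviol⟩


set_option maxHeartbeats 2000000 in
/-- **(1.5) of the source, with all parameters fixed**: for `N > 2` there are `γ, δ, Q₀ > 0` such
that for `Q > Q₀` and `a ≠ 0`, `|a| ≤ Q`, `ω(a) < (log Q)^γ`, at least `Q^{1−1/log log Q}` moduli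
`Q < q ≤ 2Q` coprime to `a` satisfy `π(q log^N q; q, a) > (1 + δ) π(q log^N q)/φ(q)`.
[cite: FriedlanderGranville1992, Theorem p. 20, (1.5)] -/
theorem core15 {N : ℝ} (hN : 2 < N) :
    ∃ γ δ Q₀ : ℝ, 0 < γ ∧ 0 < δ ∧ 0 < Q₀ ∧
      ∀ Q : ℝ, Q₀ < Q → ∀ a : ℤ, a ≠ 0 → |(a : ℝ)| ≤ Q →
        ((ω a.natAbs : ℕ) : ℝ) < Real.log Q ^ γ →
          Q ^ (1 - 1 / Real.log (Real.log Q)) ≤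
              (#((Icc 1 ⌊2 * Q⌋₊).filter fun q : ℕ =>
                  Q < (q : ℝ) ∧ Int.gcd (q : ℤ) a = 1 ∧
                    (1 + δ) * ((Nat.primeCounting ⌊(q : ℝ) * Real.log q ^ N⌋₊ : ℝ) /
                        (Nat.totient q : ℝ)) <
                      (primeCountingModInt q a ((q : ℝ) * Real.log q ^ N) : ℝ)) : ℝ) := by
  classical
  -- ### constants depending on `N`
  have hN0 : 0 < N := by linarith
  have hN1 : 1 ≤ N := by linarith
  set m : ℕ := ⌈N⌉₊ with hm
  have hmN : N ≤ m := Nat.le_ceil N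
  set k : ℕ := 6 * m with hk
  have hkeven : Even k := ⟨3 * m, by rw [hk]; ring⟩
  have hkR : (k : ℝ) = 6 * m := by rw [hk]; push_cast; ring
  have hk5 : 5 * N < k + 1 := by rw [hkR]; linarith
  have hkpos : (0 : ℝ) < k := by rw [hkR]; linarith
  have hk1pos : (0 : ℝ) < k + 1 := by linarith
  set t : ℝ := N / (k + 1) with htdef
  have ht0 : 0 < t := div_pos hN0 hk1pos
  have ht5 : t < 1 / 5 := by rw [htdef, div_lt_iff₀ hk1pos]; linarith
  have htk : t < N / k := by rw [htdef]; exact div_lt_div_of_pos_left hN0 hkpos (by linarith)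
  set g : ℝ := min (N / k - t) (1 / 5 - t) with hgdef
  have hg0 : 0 < g := lt_min (by linarith) (by linarith)
  have hg1 : g ≤ N / k - t := min_le_left _ _
  have hg2 : g ≤ 1 / 5 - t := min_le_right _ _
  set c : ℝ := t + g / 4 with hcdef
  set b' : ℝ := t + g / 2 with hb'def
  have hc0 : 0 < c := by rw [hcdef]; positivity
  have hcb' : c < b' := by rw [hcdef, hb'def]; linarith
  have hb'5 : b' < 1 / 5 := by rw [hb'def]; linarith
  have hb'0 : 0 < b' := by linarith
  have hb'1 : b' < 1 := by linarith
  have hb'k : b' * k < N := by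
    have : b' < N / k := by rw [hb'def]; linarith
    rwa [lt_div_iff₀ hkpos] at this
  have hck : N < c * (k + 1) := by
    have : t < c := by rw [hcdef]; linarith
    have := mul_lt_mul_of_pos_right this hk1pos
    rwa [htdef, div_mul_cancel₀ _ hk1pos.ne'] at this
  set ℓ : ℝ := Real.log b' - Real.log c with hℓdef
  have hℓ0 : 0 < ℓ := by rw [hℓdef]; linarith [Real.log_lt_log hc0 hcb']
  have hℓ7 : ℓ < 7 / 10 := by
    have h2 : b' < 2 * c := by rw [hcdef, hb'def]; linarith
    have : Real.log b' < Real.log (2 * c) := Real.log_lt_log hb'0 h2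
    rw [Real.log_mul two_ne_zero hc0.ne'] at this
    have hlog2 : Real.log 2 < 7 / 10 := by have := Real.log_two_lt_d9; linarith
    rw [hℓdef]; linarith
  set η : ℝ := (ℓ / 2) ^ (k + 1) / (k + 1).factorial with hηdef
  have hη0 : 0 < η := by rw [hηdef]; positivity
  have hη1 : η ≤ 1 := by
    rw [hηdef, div_le_one (by exact_mod_cast (k + 1).factorial_pos)]
    calc (ℓ / 2) ^ (k + 1) ≤ 1 ^ (k + 1) := pow_le_pow_left₀ (by linarith) (by linarith) _
      _ = 1 := one_pow _
      _ ≤ (k + 1).factorial := by exact_mod_cast (k + 1).factorial_pos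
  set ε : ℝ := η / 20000 with hεdef
  have hε0 : 0 < ε := by rw [hεdef]; positivity
  have hεη : ε ≤ η / 100 := by rw [hεdef]; linarith
  set θ₁ : ℝ := (N - b' * k) / 2 with hθ₁def
  have hθ₁0 : 0 < θ₁ := by rw [hθ₁def]; linarith
  have hθ₁N : b' * k + θ₁ < N := by rw [hθ₁def]; linarith
  -- the sieve constants
  obtain ⟨C_B, hC_B0, hCB⟩ := shiftedSiftedCount_window_ge_of_even
  obtain ⟨C_F, hC_F0, hCF⟩ := abs_apSiftedCount_sub_le
  set e5 : ℝ := Real.exp 5 with he5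
  have he50 : 0 < e5 := Real.exp_pos 5
  set sstar : ℝ := max 1 (Real.log (20000 * Real.exp 1 * C_B / η)) with hsstar
  have hsstar1 : 1 ≤ sstar := le_max_left _ _
  have hsstar0 : 0 < sstar := by linarith
  set γ : ℝ := min (c / 6) (min (θ₁ / 4) (θ₁ / (4 * sstar))) with hγdef
  have hγ0 : 0 < γ := lt_min (by positivity) (lt_min (by positivity) (by positivity))
  have hγc : γ ≤ c / 6 := min_le_left _ _
  have hγθ : γ ≤ θ₁ / 4 := (min_le_right _ _).trans (min_le_left _ _)
  have hγs : γ ≤ θ₁ / (4 * sstar) := (min_le_right _ _).trans (min_le_right _ _)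
  have hγ1 : 2 * γ < 1 := by linarith
  set C₀ : ℝ := 5000 * γ * e5 / η + 2 with hC₀def
  have hC₀pos' : 0 ≤ 5000 * γ * e5 / η := by positivity
  have hC₀2 : 2 ≤ C₀ := by rw [hC₀def]; linarith
  have hC₀0 : 0 < C₀ := by linarith
  have hηC₀ : η * C₀ = 5000 * γ * e5 + 2 * η := by rw [hC₀def]; field_simp
  set A : ℝ := 4 * C₀ + 300000 * γ * e5 / η + 8 with hAdef
  have hApos' : 0 ≤ 300000 * γ * e5 / η := by positivity
  have hA0 : 0 < A := by rw [hAdef]; linarith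
  have hAC₀ : C₀ ≤ A / 4 := by rw [hAdef]; linarith
  have hηA : η * A = 4 * η * C₀ + 300000 * γ * e5 + 8 * η := by rw [hAdef]; field_simp
  set V₁c : ℝ := 3 * γ * e5 with hV₁c
  have hV₁c0 : 0 < V₁c := by positivity
  -- the analytic constants
  obtain ⟨x₀, hx₀⟩ := primeCounting_bounds hε0
  obtain ⟨XA₀, hXA₀⟩ := Literature.NumberTheory.LFunctions.PageUniformPNT.chebyshevPsiMod_uniform_conductor
    (b := 1 / 5) (by norm_num) (by norm_num) hε0 hA0
  have hkeyB : C_B * Real.exp (-(θ₁ / (3 * γ))) * Real.exp 1 ≤ η / 20000 := keyB_le hC_B0 hη0 hθ₁0 hγ0 hsstar hγs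
  -- ### the conditions on `L = log Q`
  have F1 : ∀ᶠ L : ℝ in atTop,
      |Literature.NumberTheory.LFunctions.Mertens.primeRecipSum (L ^ b') -
          Literature.NumberTheory.LFunctions.Mertens.primeRecipSum (L ^ c) - ℓ| ≤ ℓ / 8 :=
    Maier.eventually_abs_primeRecipSum_window hc0 hb'0 (by positivity)
  have F2 : ∀ᶠ L : ℝ in atTop, 2 * (k + 3) / ℓ ≤ L ^ c ∧ 16 / ℓ ≤ L ^ c ∧ 4 * k / ℓ ≤ L ^ c ∧ 1 ≤ L ^ c :=
    ((tendsto_rpow_atTop hc0).eventually_ge_atTop _).and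
      (((tendsto_rpow_atTop hc0).eventually_ge_atTop _).and
        (((tendsto_rpow_atTop hc0).eventually_ge_atTop _).and
          ((tendsto_rpow_atTop hc0).eventually_ge_atTop _)))
  have hγc' : γ < c := by linarith
  have F3 : ∀ᶠ L : ℝ in atTop, L ^ γ + 3 ≤ ℓ / 16 * L ^ c := by
    filter_upwards [Maier.eventually_const_mul_rpow_le (C := 1) hγc' (by positivity : 0 < ℓ / 32),
      (tendsto_rpow_atTop hc0).eventually_ge_atTop (96 / ℓ)] with L h1 h2
    have h3 : 3 ≤ ℓ / 32 * L ^ c := by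
      have := (div_le_iff₀ hℓ0).1 h2; nlinarith
    linarith
  have F4 := facts_sizes₁ hC₀0 hγ0 (show 2 * γ < c by linarith) (show 2 * γ < θ₁ by linarith) hγ1
  have F4' := facts_sizes₂ hN0 hmN hA0 hcb'.le XA₀ x₀
  have F5 := facts_split hA0
  have F6 := facts_range hN0 hb'5
  have F7 := facts_windowErr (k := k) hb'0 hθ₁0 hθ₁N hV₁c0 hη0
  have F8 := facts_omega hγ0 hV₁c0 hη0
  have F9 := facts_X hη0 hη1
  have F10 := facts_sqrtX hb'1 hη0
  have F11 := facts_rows hN1 hη0 hη1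
  have F12 := facts_rowFL hC_F0 hγ0 hη0
  have F13 := facts_Drow hb'1 hV₁c0 hη0
  have F14 := facts_weights hb'1 hV₁c0 hη0
  have F15 := facts_s5a (show 1 < N by linarith) hV₁c0 hη0
  have F16 := facts_s5b hN0 hb'1 hV₁c0 hη0
  have F17 := facts_s5c hb'0.le hb'1 hV₁c0 hη0
  obtain ⟨L₀, hL₀⟩ := eventually_atTop.1 (F1.and (F2.and (F3.and (F4.and (F4'.and (F5.and (F6.and (F7.and
    (F8.and (F9.and (F10.and (F11.and (F12.and (F13.and (F14.and (F15.and (F16.and F17)))))))))))))))))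
  refine ⟨γ, η / 20, Real.exp L₀, hγ0, by positivity, Real.exp_pos _, ?_⟩
  intro Q hQ a ha0 haQ hω
  have hQ0 : 0 < Q := (Real.exp_pos _).trans hQ
  set L := Real.log Q with hLdef
  have hQL : Real.exp L = Q := Real.exp_log hQ0
  have hLL₀ : L₀ ≤ L := by rw [hLdef, Real.le_log_iff_exp_le hQ0]; exact hQ.le
  obtain ⟨f1, f2, f3, ⟨f4a, f4b, f4c, f4d, f4e, f4f⟩, ⟨g1, g2, ⟨g3, g4⟩, g5, g6, g7, g8, g9⟩, f5, f6, f7, f8,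
    f9, f10, ⟨f11, f11b⟩, f12, f13, f14, f15, f16, f17⟩ := hL₀ L hLL₀
  rw [hQL] at g3 g4 g5 g6 f9 f10 f13 f14 f16 f17
  have hωR : (a.natAbs.primeFactors.card : ℝ) ≤ L ^ γ := by
    have : ((ω a.natAbs : ℕ) : ℝ) = a.natAbs.primeFactors.card := by
      rw [ArithmeticFunction.cardDistinctFactors_apply, ← List.card_toFinset]; rfl
    rw [← this]; exact hω.le
  exact core15_main hCB hCF hC_B0 hC_F0 hN hcb' hck hℓ0 hℓ7 hη0 hη1 hηdef hεdef hθ₁0 hγ0 hC₀0 hηC₀ hA0 hηA hAC₀ hV₁c he5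
    hkeven hkeyB hx₀ (hXA₀ (Q / L ^ 2) g3) f1 f2 f3 f4a f4b f4c f4d f4e f4f g1 g2 g4 g5 g6 g7 g8 g9 f5 f6 f7 f8 f9
    f10 f11 f11b f12 f13 f14 f15 f16 f17 hQ0 hQL ha0 haQ hωR





/-! ## The proof of (1.6) -/

/-- The prime number theorem for ALL live columns (no bad moduli). [folklore] -/
theorem pnt_all_columns {a : ℤ} {P y X d : ℕ} {ε X_A T₀ : ℝ} (hP : 1 ≤ P)
    (haP : IsCoprime a (P : ℤ))
    (hA : ∀ q : ℕ, 1 ≤ q → Real.log q ≤ T₀ → ¬ d ∣ q → ∀ u : (ZMod q)ˣ, ∀ x : ℝ, X_A ≤ x →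
      |ParityWave0.chebyshevPsiMod q u x - x / q.totient| ≤ ε * (x / q.totient))
    (hlog : ∀ r : ℕ, 1 ≤ r → r ≤ y → Real.log ((r * P : ℕ) : ℝ) ≤ T₀)
    (hgood : ∀ r : ℕ, 1 ≤ r → r ≤ y → ¬ d ∣ r * P) (hX : X_A ≤ (X : ℝ)) :
    ∀ r ∈ (liveSet a y P).filter (fun r ↦ ¬ 0 ∣ r), ∀ x : ℝ, (X : ℝ) ≤ x →
      |ParityWave0.chebyshevPsiMod (r * P) ((colResidue a r P : ℕ) : ZMod (r * P)) x -
          x / ((r * P).totient : ℝ)| ≤ ε * (x / ((r * P).totient : ℝ)) := by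
  intro r hr x hx
  rw [mem_filter, liveSet, mem_filter, mem_Icc] at hr
  obtain ⟨⟨⟨hr1, hry⟩, hcop, hcopP⟩, -⟩ := hr
  have hq1 : 1 ≤ r * P := Nat.mul_pos hr1 hP
  have hj : (colResidue a r P).Coprime (r * P) := (coprime_colResidue_iff hr1 hP haP).2 ⟨hcop, hcopP⟩
  have h := hA (r * P) hq1 (hlog r hr1 hry) (hgood r hr1 hry) (ZMod.unitOfCoprime _ hj) x (hX.trans hx)
  rwa [ZMod.coe_unitOfCoprime] at h

set_option maxHeartbeats 6000000 in
/-- **The proof of (1.6) at a given large `Q`**: the deterministic core `core16_at` with the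
parameters of the source (odd `k`; no bad columns, by `exceptional_nobad`), all conditions on
`L = log Q` entering as hypotheses. [cite: FriedlanderGranville1992, §5] -/
theorem core16_main
    {C_B : ℝ} (hCB : ∀ (T U S : Finset ℕ) (z w : ℝ) (y k : ℕ) (D : ℝ),
      (∀ p ∈ T, p.Prime) → (∀ p ∈ U, p.Prime) → (∀ p ∈ S, p.Prime) →
      (∀ p ∈ T, (p : ℝ) < z) → (∀ p ∈ U, (p : ℝ) < z) → (∀ p ∈ S, z ≤ (p : ℝ)) →
      (∀ p ∈ T, p ∉ U) → 1 ≤ w → (∀ p ∈ S, w < p) → ((y : ℝ) + 1 ≤ w ^ (k + 1)) →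
      2 ≤ z → z ≤ D → Odd k →
        (shiftedSiftedCount y T (U ∪ S) : ℝ) ≤
          y * sieveDensity (T ∪ U) * sieveDensity S * (1 - eSymm S (k + 1)) +
            (C_B * Real.exp (-(Real.log D / Real.log z)) * y * sieveDensity (T ∪ U) *
                ∏ p ∈ S, (1 + (p : ℝ)⁻¹) + (k + 1) * (#S + 1) ^ k * D))
    {C_F : ℝ} (hCF : ∀ (Ps : Finset ℕ) (z : ℝ), (∀ p ∈ Ps, p.Prime) → (∀ p ∈ Ps, (p : ℝ) < z) →
      ∀ (e : ℕ), 0 < e → (∀ p ∈ Ps, ¬ p ∣ e) → ∀ (X₁ y c : ℕ) (D : ℝ), 2 ≤ z → z ≤ D →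
        |(apSiftedCount X₁ y e c Ps : ℝ) - (y : ℝ) / e * sieveDensity Ps| ≤
          C_F * ((y : ℝ) / e) * sieveDensity Ps * Real.exp (-(Real.log D / Real.log z)) + D)
    (hC_B0 : 0 < C_B) (hC_F0 : 0 < C_F)
    {N c b' ℓ η ε θ₁ γ C₀ A V₁c e5 x₀ L Q : ℝ} {k R : ℕ} {a : ℤ}
    (hN : 2 < N) (hcb' : c < b') (hℓ0 : 0 < ℓ) (hℓ7 : ℓ < 7 / 10)
    (hη0 : 0 < η) (hη1 : η ≤ 1) (hηdef : η = (ℓ / 2) ^ (k + 1) / (k + 1).factorial)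
    (hεdef : ε = η / 20000) (hθ₁0 : 0 < θ₁) (hγ0 : 0 < γ) (hC₀0 : 0 < C₀)
    (hηC₀ : η * C₀ = 20000 * γ * e5 + 2 * η) (hV₁c : V₁c = 3 * γ * e5) (he5 : e5 = Real.exp 5) (hkodd : Odd k)
    (hkeyB : C_B * Real.exp (-(θ₁ / (3 * γ))) * Real.exp 1 ≤ η / 20000)
    (hx₀ : ∀ x : ℝ, x₀ ≤ x → |(Nat.primeCounting ⌊x⌋₊ : ℝ) - x / Real.log x| ≤ ε * (x / Real.log x))
    (hPage : ∃ d : ℕ, (d = 0 ∨ Real.log (Q / L ^ 2) ^ A ≤ d) ∧ ∀ q : ℕ, 1 ≤ q →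
      Real.log q ≤ Real.log (Q / L ^ 2) ^ (1 / 5 : ℝ) → ¬ d ∣ q → ∀ u : (ZMod q)ˣ, ∀ x : ℝ, Q / L ^ 2 ≤ x →
        |ParityWave0.chebyshevPsiMod q u x - x / q.totient| ≤ ε * (x / q.totient))
    -- the conditions on `L`
    (f1 : |Literature.NumberTheory.LFunctions.Mertens.primeRecipSum (L ^ b') -
        Literature.NumberTheory.LFunctions.Mertens.primeRecipSum (L ^ c) - ℓ| ≤ ℓ / 8)
    (f2 : 2 * (k + 3) / ℓ ≤ L ^ c ∧ 16 / ℓ ≤ L ^ c ∧ 4 * k / ℓ ≤ L ^ c ∧ 1 ≤ L ^ c)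
    (f3 : L ^ γ + R + 1 ≤ ℓ / 16 * L ^ c)
    (f4a : 2 ≤ C₀ * Real.log L) (f4b : C₀ * Real.log L ≤ L ^ (2 * γ)) (f4c : L ^ (2 * γ) + 2 ≤ L ^ (3 * γ))
    (f4d : L ^ (2 * γ) + 1 ≤ L ^ c) (f4e : L ^ (2 * γ) + 1 ≤ L ^ θ₁) (f4f : L ^ (2 * γ) + 1 ≤ Real.exp (L / 2))
    (g4 : 2 ≤ Q / L ^ 2) (g5 : Q / L ^ 2 + 2 ≤ Q) (g6 : x₀ ≤ Q) (g7 : 4 ≤ L) (g8 : L ^ c ≤ L ^ b')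
    (g10 : 4 * Real.log L ≤ L)
    (gy1 : (L + Real.log 2) ^ N + 2 ≤ L ^ (N + 1)) (gy2 : (L + Real.log 2) ^ N + 3 ≤ L ^ (c * (k + 1)))
    (gy3 : L ^ (N + 1) * L ^ b' < (L ^ c) ^ (R + 1)) (gy4 : 3 * ((L + Real.log 2) ^ N + 2) ≤ Real.exp (L / 4))
    (f5 : L ^ (2 * (N + 1)) * (4 : ℝ) ^ (C₀ * Real.log L) < (L - 2 * Real.log L) ^ A)
    (f6 : (N + 1) * Real.log L + Real.log 4 * (L ^ b' + 1) ≤ (L - 2 * Real.log L) ^ (1 / 5 : ℝ))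
    (f7 : (k + 1) * (L ^ b' + 2) ^ k * L ^ θ₁ * (V₁c * Real.log L) * (20000 / η) ≤ L ^ N - 2)
    (f8 : 20000 * V₁c * Real.log L * L ^ γ ≤ η * L ^ (2 * γ))
    (f12 : C_F * Real.exp (-(L / 2 / (3 * γ * Real.log L))) ≤ η / 400)
    (f13 : 400 * V₁c * Real.log L * Real.exp (L / 2) * (4 : ℝ) ^ (L ^ b' + 1) ≤ η * (Q - 1))
    (ft1 : (1 - η / 100) * ((L + Real.log 2) ^ N + 2) * (L + Real.log 2 + N * Real.log (L + Real.log 2)) ≤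
      (1 - η / 20000) * L ^ N * (L - 2 * Real.log L))
    (ft2 : 100 * (L + Real.log 2 + N * Real.log (L + Real.log 2)) ≤ η * ((1 - η / 20) * ((1 - η / 20000) * L ^ N)))
    (fcolA : 300 * L * (V₁c * Real.log L) * (4 : ℝ) ^ (L ^ b' + 1) ≤ η * (Q - 1))
    (fcolB : 600 * L * (V₁c * Real.log L) * (Q / L ^ 2 + 1) ≤ η * (Q - 1))
    (fcolC : 600 * (1 + 8 * Real.exp (5 * L / 8)) * L * (V₁c * Real.log L) * (4 : ℝ) ^ (L ^ b' + 1) ≤ η * (Q - 1))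
    (fom : 800 * L ^ γ * (V₁c * Real.log L) * (4 : ℝ) ^ (L ^ b' + 1) ≤ η * (Q - 1))
    (fBv : 400 * Real.exp (L - L / Real.log L) * (V₁c * Real.log L) * (4 : ℝ) ^ (L ^ b' + 1) ≤ η * (Q - 1))
    -- `Q` and `a`
    (hQ0 : 0 < Q) (hQL : Real.exp L = Q) (ha0 : a ≠ 0) (haQ : |(a : ℝ)| ≤ Q)
    (hωR : (a.natAbs.primeFactors.card : ℝ) ≤ L ^ γ) :
    Q ^ (1 - 1 / Real.log L) ≤
      (#((Icc 1 ⌊2 * Q⌋₊).filter fun q : ℕ =>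
          Q < (q : ℝ) ∧ Int.gcd (q : ℤ) a = 1 ∧
            (primeCountingModInt q a ((q : ℝ) * Real.log q ^ N) : ℝ) <
              (1 - η / 20) * ((Nat.primeCounting ⌊(q : ℝ) * Real.log q ^ N⌋₊ : ℝ) / (Nat.totient q : ℝ))) : ℝ) := by
  classical
  have hN0 : 0 < N := by linarith only [hN]
  have hN1 : 1 ≤ N := by linarith only [hN]
  have hLQ : Real.log Q = L := by rw [← hQL, Real.log_exp]
  have hε0 : 0 < ε := by rw [hεdef]; positivity
  have hε1 : ε ≤ 1 := by rw [hεdef]; linarith only [hη1, hη0]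
  have he50 : 0 < e5 := by rw [he5]; exact Real.exp_pos 5
  have hV₁c0 : 0 < V₁c := by rw [hV₁c]; positivity
  have hL1 : 1 ≤ L := by linarith only [g7]
  have hL0 : 0 < L := by linarith only [g7]
  have hlogL : 0 < Real.log L := Real.log_pos (by linarith only [g7])
  have h2e : (2 : ℝ) ≤ Real.exp 1 := by linarith only [Real.add_one_le_exp (1 : ℝ)]
  have hQ16 : 16 ≤ Q := by
    rw [← hQL]
    have h1 : Real.exp 4 ≤ Real.exp L := Real.exp_le_exp.2 g7
    have h2 : Real.exp 4 = Real.exp 1 ^ 4 := by rw [← Real.exp_nat_mul]; norm_num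
    have h3 : (2 : ℝ) ^ 4 ≤ Real.exp 1 ^ 4 := pow_le_pow_left₀ (by norm_num) h2e 4
    calc (16 : ℝ) = 2 ^ 4 := by norm_num
      _ ≤ Real.exp 1 ^ 4 := h3
      _ = Real.exp 4 := h2.symm
      _ ≤ Real.exp L := h1
  have hQ4 : 4 ≤ Q := by linarith only [hQ16]
  obtain ⟨hQ12, hQ₁le, hQ₁lt, hQ₂le, hQ₂lt, hQ₂2⟩ := Qfloor_facts hQ4
  -- `y = ⌊(L + log 2)^N⌋ + 2`, `Y0 = (L + log 2)^N`
  have hlog2 : 0 ≤ Real.log 2 := Real.log_nonneg (by norm_num)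
  have hY0 : 0 ≤ (L + Real.log 2) ^ N := Real.rpow_nonneg (by linarith only [hL0, hlog2]) N
  have hy_le : ((⌊(L + Real.log 2) ^ N⌋₊ + 2 : ℕ) : ℝ) ≤ (L + Real.log 2) ^ N + 2 := by
    push_cast; linarith only [Nat.floor_le hY0]
  have hy_gt : (L + Real.log 2) ^ N + 1 < ((⌊(L + Real.log 2) ^ N⌋₊ + 2 : ℕ) : ℝ) := by
    push_cast; linarith only [Nat.lt_floor_add_one ((L + Real.log 2) ^ N)]
  have hy1 : 1 ≤ ⌊(L + Real.log 2) ^ N⌋₊ + 2 := by omega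
  have hy0 : (0 : ℝ) ≤ ((⌊(L + Real.log 2) ^ N⌋₊ + 2 : ℕ) : ℝ) := Nat.cast_nonneg _
  have hLN_le : L ^ N ≤ (L + Real.log 2) ^ N := Real.rpow_le_rpow hL0.le (by linarith only [hlog2]) hN0.le
  have hyR : L ^ N - 2 ≤ ((⌊(L + Real.log 2) ^ N⌋₊ + 2 : ℕ) : ℝ) := by linarith only [hLN_le, hy_gt]
  have hyL : (((⌊(L + Real.log 2) ^ N⌋₊ + 2 : ℕ)) : ℝ) ≤ L ^ (N + 1) := hy_le.trans gy1
  have hQL2 : 0 ≤ Q / L ^ 2 := by positivity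
  have hXge : Q / L ^ 2 ≤ (⌈Q / L ^ 2⌉₊ : ℝ) := Nat.le_ceil _
  have hXlt : ((⌈Q / L ^ 2⌉₊ : ℕ) : ℝ) < Q / L ^ 2 + 1 := Nat.ceil_lt_add_one hQL2
  have hwT0 : 0 < L ^ (2 * γ) := Real.rpow_pos_of_pos hL0 _
  have hwT1 : 1 ≤ L ^ (2 * γ) := Real.one_le_rpow hL1 (by positivity)
  have hnT1 : 1 ≤ ⌊L ^ (2 * γ)⌋₊ := Nat.le_floor (by simpa using hwT1)
  have hnTle : (⌊L ^ (2 * γ)⌋₊ : ℝ) ≤ L ^ (2 * γ) := Nat.floor_le hwT0.le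
  have hm₀n : ⌊C₀ * Real.log L⌋₊ ≤ ⌊L ^ (2 * γ)⌋₊ := Nat.floor_mono f4b
  have hm₀le : (⌊C₀ * Real.log L⌋₊ : ℝ) ≤ C₀ * Real.log L := Nat.floor_le (by positivity)
  have hm₀1 : 1 ≤ ⌊C₀ * Real.log L⌋₊ := Nat.le_floor (by push_cast; linarith only [f4a])
  have hm₀nR : (⌊C₀ * Real.log L⌋₊ : ℝ) ≤ ⌊L ^ (2 * γ)⌋₊ := by exact_mod_cast hm₀n
  -- the sets of primes
  obtain ⟨T, hTdef⟩ : ∃ T : Finset ℕ, T = (Nat.primesLE ⌊L ^ (2 * γ)⌋₊).filter (fun p ↦ p ∣ a.natAbs) := ⟨_, rfl⟩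
  obtain ⟨U, hUdef⟩ : ∃ U : Finset ℕ, U = (Nat.primesLE ⌊C₀ * Real.log L⌋₊).filter (fun p ↦ ¬ p ∣ a.natAbs) :=
    ⟨_, rfl⟩
  obtain ⟨S₀, hS₀def⟩ : ∃ S₀ : Finset ℕ,
      S₀ = (Nat.primesLE ⌊L ^ b'⌋₊ \ Nat.primesLE ⌊L ^ c⌋₊).filter (fun p ↦ ¬ p ∣ a.natAbs) := ⟨_, rfl⟩
  have hT : ∀ p ∈ T, p.Prime ∧ p ∣ a.natAbs := fun p hp ↦ by
    rw [hTdef, mem_filter] at hp; exact ⟨Nat.prime_of_mem_primesLE hp.1, hp.2⟩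
  have hTp : ∀ p ∈ T, p.Prime := fun p hp ↦ (hT p hp).1
  have hTn : ∀ p ∈ T, p ≤ ⌊L ^ (2 * γ)⌋₊ := fun p hp ↦ by
    rw [hTdef, mem_filter] at hp; exact (Nat.mem_primesLE.1 hp.1).1
  have hU : ∀ p ∈ U, p.Prime := fun p hp ↦ by rw [hUdef, mem_filter] at hp; exact Nat.prime_of_mem_primesLE hp.1
  have hUa : ∀ p ∈ U, ¬ p ∣ a.natAbs := fun p hp ↦ by rw [hUdef, mem_filter] at hp; exact hp.2
  have hUm : ∀ p ∈ U, p ≤ ⌊C₀ * Real.log L⌋₊ := fun p hp ↦ by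
    rw [hUdef, mem_filter] at hp; exact (Nat.mem_primesLE.1 hp.1).1
  have hS₀ : ∀ p ∈ S₀, p.Prime := fun p hp ↦ by
    rw [hS₀def, mem_filter] at hp; exact Nat.prime_of_mem_primesLE (mem_sdiff.1 hp.1).1
  have hS₀a : ∀ p ∈ S₀, ¬ p ∣ a.natAbs := fun p hp ↦ by rw [hS₀def, mem_filter] at hp; exact hp.2
  have hS₀W : S₀ ⊆ Nat.primesLE ⌊L ^ b'⌋₊ \ Nat.primesLE ⌊L ^ c⌋₊ := by rw [hS₀def]; exact filter_subset _ _
  have hLc0 : 0 < L ^ c := Real.rpow_pos_of_pos hL0 c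
  have hS₀w : ∀ p ∈ S₀, L ^ c ≤ (p : ℝ) := by
    intro p hp
    obtain ⟨hp1, hp2⟩ := mem_sdiff.1 (hS₀W hp)
    have hpp := Nat.prime_of_mem_primesLE hp1
    have : ¬ p ≤ ⌊L ^ c⌋₊ := fun hle ↦ hp2 (Nat.mem_primesLE.2 ⟨hle, hpp⟩)
    exact ((Nat.floor_lt hLc0.le).1 (not_le.1 this)).le
  have hS₀B : ∀ p ∈ S₀, (p : ℝ) ≤ L ^ b' := fun p hp ↦
    (Nat.le_floor_iff (Real.rpow_nonneg hL0.le b')).1 (Nat.mem_primesLE.1 (mem_sdiff.1 (hS₀W hp)).1).1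
  have hTU : ∀ p ∈ T ∪ U, p.Prime := fun p hp ↦ (mem_union.1 hp).elim (hTp p) (hU p)
  -- Page's theorem at `X_A = Q/L²`; no bad columns
  obtain ⟨d, hdsize, hdPNT⟩ := hPage
  have hUK : ∀ p ∈ U, (p : ℝ) ≤ C₀ * Real.log L := by
    intro p hp
    have : (p : ℝ) ≤ ⌊C₀ * Real.log L⌋₊ := by exact_mod_cast hUm p hp
    exact this.trans hm₀le
  have hdsplit : d = 0 ∨ ((((⌊(L + Real.log 2) ^ N⌋₊ + 2 : ℕ)) : ℝ)) ^ 2 * 4 ^ ⌊C₀ * Real.log L⌋₊ < d :=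
    split_hyp₂ hL1 hC₀0 hyL f5 (by rwa [hQL])
  have hw1 : 1 < L ^ c := by
    have : (16 : ℝ) / ℓ ≤ L ^ c := f2.2.1
    have h16 : (20 : ℝ) ≤ 16 / ℓ := by rw [le_div_iff₀ hℓ0]; linarith only [hℓ7]
    linarith only [this, h16]
  have hRhyp : ((((⌊(L + Real.log 2) ^ N⌋₊ + 2 : ℕ)) : ℝ)) * L ^ b' < (L ^ c) ^ (R + 1) := by
    have : ((((⌊(L + Real.log 2) ^ N⌋₊ + 2 : ℕ)) : ℝ)) * L ^ b' ≤ L ^ (N + 1) * L ^ b' :=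
      mul_le_mul_of_nonneg_right hyL (Real.rpow_nonneg hL0.le b')
    exact lt_of_le_of_lt this gy3
  obtain ⟨S, hSS₀, hScard, hgood⟩ := exceptional_nobad U S₀ hU hS₀ hUK hw1 hS₀w hS₀B hy1 hRhyp d hdsplit
  -- the window facts for `S`
  have hSW : S ⊆ Nat.primesLE ⌊L ^ b'⌋₊ \ Nat.primesLE ⌊L ^ c⌋₊ := hSS₀.trans hS₀W
  have hωcard : a.natAbs.primeFactors.card ≤ ⌊L ^ γ⌋₊ := Nat.le_floor hωR
  have hRcount : #(Nat.primesLE ⌊L ^ b'⌋₊ \ Nat.primesLE ⌊L ^ c⌋₊) ≤ #S + (R + ⌊L ^ γ⌋₊) := by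
    have h1 := Finset.card_filter_add_card_filter_not (s := Nat.primesLE ⌊L ^ b'⌋₊ \ Nat.primesLE ⌊L ^ c⌋₊)
      (fun p ↦ ¬ p ∣ a.natAbs)
    rw [← hS₀def] at h1
    have h2 : #((Nat.primesLE ⌊L ^ b'⌋₊ \ Nat.primesLE ⌊L ^ c⌋₊).filter fun p ↦ ¬¬ p ∣ a.natAbs) ≤
        a.natAbs.primeFactors.card := by
      refine card_le_card fun p hp ↦ ?_
      rw [mem_filter, not_not] at hp
      exact Nat.mem_primeFactors.2 ⟨Nat.prime_of_mem_primesLE (mem_sdiff.1 hp.1).1, hp.2, Int.natAbs_ne_zero.2 ha0⟩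
    omega
  have hRc : (((R + ⌊L ^ γ⌋₊ : ℕ)) : ℝ) / L ^ c ≤ ℓ / 16 := by
    rw [div_le_iff₀ hLc0]
    have : (⌊L ^ γ⌋₊ : ℝ) ≤ L ^ γ := Nat.floor_le (Real.rpow_nonneg hL0.le _)
    push_cast; linarith only [this, f3]
  obtain ⟨heS, hW5, hSsum, -, hScardR, hSprops⟩ := window_facts hcb' hL1 hℓ0 hℓ7 f1 f2 hRc hSW hRcount
  have heS' : η ≤ eSymm S (k + 1) := by rw [hηdef]; exact heS
  have hS : ∀ p ∈ S, p.Prime := fun p hp ↦ (hSprops p hp).1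
  have hSa : ∀ p ∈ S, ¬ p ∣ a.natAbs := fun p hp ↦ hS₀a p (hSS₀ hp)
  have hSgt : ∀ p ∈ S, L ^ c < p := fun p hp ↦ (hSprops p hp).2.1
  have hSle : ∀ p ∈ S, (p : ℝ) ≤ L ^ b' := fun p hp ↦ (hSprops p hp).2.2
  have hUS : ∀ p ∈ U ∪ S, p.Prime := fun p hp ↦ (mem_union.1 hp).elim (hU p) (hS p)
  have hUSa : ∀ p ∈ U ∪ S, ¬ p ∣ a.natAbs := fun p hp ↦ (mem_union.1 hp).elim (hUa p) (hSa p)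
  have hP0 : 0 < ∏ p ∈ U ∪ S, p := prod_pos fun p hp ↦ (hUS p hp).pos
  have hP1 : 1 ≤ ∏ p ∈ U ∪ S, p := hP0
  have hP0R : (0 : ℝ) < (∏ p ∈ U ∪ S, p : ℕ) := by exact_mod_cast hP0
  have hUSle : ∀ p ∈ U ∪ S, (p : ℝ) ≤ L ^ b' + 1 := by
    intro p hp
    rcases mem_union.1 hp with h | h
    · have : (p : ℝ) ≤ ⌊C₀ * Real.log L⌋₊ := by exact_mod_cast hUm p h
      linarith only [this, hm₀nR, hnTle, f4d, g8]
    · linarith only [hSle p h]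
  have hPle : ((∏ p ∈ U ∪ S, p : ℕ) : ℝ) ≤ (4 : ℝ) ^ (L ^ b' + 1) :=
    prod_primes_le_four_rpow (by have := Real.rpow_nonneg hL0.le b'; linarith only [this]) hUS hUSle
  have haP : IsCoprime a ((∏ p ∈ U ∪ S, p : ℕ) : ℤ) := isCoprime_prod_of_not_dvd hUS hUSa
  -- the densities: `V₁ = (V₁c log L)⁻¹`
  have hV₁pos : 0 < (V₁c * Real.log L)⁻¹ := by positivity
  have hzv3γ : (⌊L ^ (2 * γ)⌋₊ : ℝ) + 2 ≤ L ^ (3 * γ) := by linarith only [hnTle, f4c]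
  have hlognT : Real.log ((⌊L ^ (2 * γ)⌋₊ : ℝ) + 2) ≤ 3 * γ * Real.log L := by
    calc Real.log ((⌊L ^ (2 * γ)⌋₊ : ℝ) + 2) ≤ Real.log (L ^ (3 * γ)) := Real.log_le_log (by positivity) hzv3γ
      _ = 3 * γ * Real.log L := Real.log_rpow hL0 _
  have hV₁eq : (Real.exp 5 * (3 * γ * Real.log L))⁻¹ = (V₁c * Real.log L)⁻¹ := by rw [hV₁c, he5]; ring_nf
  have hV₁V : (V₁c * Real.log L)⁻¹ ≤ sieveDensity (T ∪ U) := by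
    rw [← hV₁eq]
    refine sieveDensity_ge_of_log_le hTU (n := ⌊L ^ (2 * γ)⌋₊) (fun p hp ↦ ?_) hlognT
    rcases mem_union.1 hp with h | h
    · exact hTn p h
    · exact (hUm p h).trans hm₀n
  have hV₁T : (V₁c * Real.log L)⁻¹ ≤ sieveDensity T := by
    rw [← hV₁eq]; exact sieveDensity_ge_of_log_le hTp (n := ⌊L ^ (2 * γ)⌋₊) hTn hlognT
  have hVle1 : sieveDensity (T ∪ U) ≤ 1 := (sieveDensity_nonneg_le_one (T ∪ U)).2
  have hWle1 : sieveDensity S ≤ 1 := (sieveDensity_nonneg_le_one S).2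
  have hW0 : 0 ≤ sieveDensity S := (sieveDensity_nonneg_le_one S).1
  -- `Xmax = 3 ((L + log 2)^N + 2) Q`
  have hY1 : 1 ≤ (L + Real.log 2) ^ N + 2 := by linarith only [hY0]
  obtain ⟨hXmax2, hsqrtXmax, hlogXmax2⟩ := Xmax_facts₂ hL1 hY1 gy4
  rw [hQL] at hXmax2 hsqrtXmax hlogXmax2
  have hlX0 : 0 ≤ Real.log (3 * ((L + Real.log 2) ^ N + 2) * Q) := Real.log_nonneg (by linarith only [hXmax2])
  -- ### the hypotheses of `core16_at`
  have ha_natAbs : a.natAbs ≤ ⌊Q⌋₊ := Nat.le_floor (by rw [Nat.cast_natAbs, Int.cast_abs]; exact haQ)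
  have hTz : ∀ p ∈ T, (p : ℝ) < (⌊L ^ (2 * γ)⌋₊ : ℝ) + 1 := fun p hp ↦ by
    have : (p : ℝ) ≤ ⌊L ^ (2 * γ)⌋₊ := by exact_mod_cast hTn p hp
    linarith only [this]
  have hUz : ∀ p ∈ U, (p : ℝ) < (⌊L ^ (2 * γ)⌋₊ : ℝ) + 1 := fun p hp ↦ by
    have : (p : ℝ) ≤ ⌊L ^ (2 * γ)⌋₊ := by exact_mod_cast (hUm p hp).trans hm₀n
    linarith only [this]
  have hzvc : (⌊L ^ (2 * γ)⌋₊ : ℝ) + 1 ≤ L ^ c := by linarith only [hnTle, f4d]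
  have hSz : ∀ p ∈ S, (⌊L ^ (2 * γ)⌋₊ : ℝ) + 1 ≤ (p : ℝ) := fun p hp ↦ hzvc.trans (hSgt p hp).le
  have hw : (1 : ℝ) ≤ L ^ c := f2.2.2.2
  have hyw : (((⌊(L + Real.log 2) ^ N⌋₊ + 2 : ℕ)) : ℝ) + 1 ≤ (L ^ c) ^ (k + 1) := by
    have h2 : (L ^ c) ^ (k + 1) = L ^ (c * (k + 1)) := by
      rw [← Real.rpow_natCast, ← Real.rpow_mul hL0.le]; push_cast; ring_nf
    rw [h2]; linarith only [hy_le, gy2]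
  have hz : 2 ≤ (⌊L ^ (2 * γ)⌋₊ : ℝ) + 1 := by
    have : (1 : ℝ) ≤ ⌊L ^ (2 * γ)⌋₊ := by exact_mod_cast hnT1
    linarith only [this]
  have hzD : (⌊L ^ (2 * γ)⌋₊ : ℝ) + 1 ≤ L ^ θ₁ := by linarith only [hnTle, f4e]
  have hout : ∀ p : ℕ, p.Prime → p ∣ a.natAbs → p ∉ T → L ^ (2 * γ) < p := by
    intro p hp hpa hpT
    by_contra h; push Not at h
    exact hpT (by rw [hTdef]; exact mem_filter.2 ⟨Nat.mem_primesLE.2 ⟨Nat.le_floor h, hp⟩, hpa⟩)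
  have hzTD : (⌊L ^ (2 * γ)⌋₊ : ℝ) + 1 ≤ Real.exp (L / 2) := by linarith only [hnTle, f4f]
  -- the weights of the columns
  obtain ⟨Ps, hPsdef⟩ : ∃ Ps : Finset ℕ, Ps = (Nat.primesLE (⌊(L + Real.log 2) ^ N⌋₊ + 2)).filter
      (fun p ↦ ⌊C₀ * Real.log L⌋₊ < p ∧ p ∉ U ∪ S) := ⟨_, rfl⟩
  have hPs : ∀ p ∈ Ps, p.Prime := fun p hp ↦ by
    rw [hPsdef, mem_filter] at hp; exact Nat.prime_of_mem_primesLE hp.1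
  have hPsm : ∀ p ∈ Ps, ⌊C₀ * Real.log L⌋₊ < p := fun p hp ↦ by rw [hPsdef, mem_filter] at hp; exact hp.2.1
  have hPsP : ∀ p ∈ Ps, ¬ p ∣ ∏ p ∈ U ∪ S, p := by
    intro p hp hpP
    rw [hPsdef, mem_filter] at hp
    obtain ⟨hp1, -, hp3⟩ := hp
    have hpp := Nat.prime_of_mem_primesLE hp1
    rw [(Nat.prime_iff.1 hpp).dvd_finsetProd_iff] at hpP
    obtain ⟨q, hq, hpq⟩ := hpP
    have : p = q := (Nat.prime_dvd_prime_iff_eq hpp (hUS q hq)).1 hpq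
    subst this
    exact hp3 hq
  have hfac : ∀ r ∈ liveSet a (⌊(L + Real.log 2) ^ N⌋₊ + 2) (∏ p ∈ U ∪ S, p), ∀ p ∈ r.primeFactors,
      ¬ p ∣ (∏ p ∈ U ∪ S, p) → p ∈ Ps := by
    intro r hr p hp hpP
    rw [liveSet, mem_filter, mem_Icc] at hr
    obtain ⟨⟨hr1, hry⟩, hcop, -⟩ := hr
    have hpp := Nat.prime_of_mem_primeFactors hp
    have hpr := Nat.dvd_of_mem_primeFactors hp
    have hpUS : p ∉ U ∪ S := fun h ↦ hpP (dvd_prod_of_mem _ h)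
    rw [hPsdef]
    refine mem_filter.2 ⟨Nat.mem_primesLE.2 ⟨(Nat.le_of_dvd hr1 hpr).trans hry, hpp⟩, ?_, hpUS⟩
    by_contra h; push Not at h
    have hpa : ¬ p ∣ a.natAbs := by
      intro hpa
      rw [Int.isCoprime_iff_gcd_eq_one, Int.gcd, Int.natAbs_natCast] at hcop
      have : p ∣ Nat.gcd r a.natAbs := Nat.dvd_gcd hpr hpa
      rw [hcop] at this
      exact hpp.one_lt.ne' (Nat.dvd_one.1 this)
    exact hpUS (mem_union_left _ (by rw [hUdef]; exact mem_filter.2 ⟨Nat.mem_primesLE.2 ⟨h, hpp⟩, hpa⟩))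
  have hempty : (liveSet a (⌊(L + Real.log 2) ^ N⌋₊ + 2) (∏ p ∈ U ∪ S, p)).filter (fun r ↦ 0 ∣ r) = ∅ := by
    refine filter_eq_empty_iff.2 fun r hr h0 ↦ ?_
    rw [liveSet, mem_filter, mem_Icc] at hr
    rw [zero_dvd_iff] at h0
    omega
  have hWbad : ∑ r ∈ (liveSet a (⌊(L + Real.log 2) ^ N⌋₊ + 2) (∏ p ∈ U ∪ S, p)).filter (fun r ↦ 0 ∣ r),
      primeWeight Ps r ≤ (0 : ℝ) := by rw [hempty, sum_empty]
  -- the columns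
  have hX2 : 2 ≤ ⌈Q / L ^ 2⌉₊ := by
    have : (2 : ℝ) ≤ ⌈Q / L ^ 2⌉₊ := le_trans g4 hXge
    exact_mod_cast this
  have haQ' := abs_le.1 haQ
  have hXQ : ((⌈Q / L ^ 2⌉₊ : ℕ) : ℝ) ≤ (a : ℝ) + (⌊2 * Q⌋₊ : ℕ) := by linarith only [hXlt, g5, haQ'.1, hQ₂lt]
  have hXmaxb : (a : ℝ) + ((⌊(L + Real.log 2) ^ N⌋₊ + 2 : ℕ) : ℝ) * (⌊2 * Q⌋₊ : ℕ) ≤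
      3 * ((L + Real.log 2) ^ N + 2) * Q := by
    have h1 : (((⌊(L + Real.log 2) ^ N⌋₊ + 2 : ℕ)) : ℝ) * (⌊2 * Q⌋₊ : ℕ) ≤ ((L + Real.log 2) ^ N + 2) * (2 * Q) :=
      mul_le_mul hy_le hQ₂le (Nat.cast_nonneg _) (by linarith only [hY1])
    have h2 : Q ≤ ((L + Real.log 2) ^ N + 2) * Q := le_mul_of_one_le_left hQ0.le hY1
    linarith only [haQ'.2, h1, h2]
  have hBT : ∀ r ∈ (liveSet a (⌊(L + Real.log 2) ^ N⌋₊ + 2) (∏ p ∈ U ∪ S, p)).filter (fun r ↦ 0 ∣ r),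
      (colCount (r * ∏ p ∈ U ∪ S, p) (colResidue a r (∏ p ∈ U ∪ S, p)) (colEnd a r ⌊Q⌋₊) (colEnd a r ⌊2 * Q⌋₊) : ℝ) ≤
        0 * (((colEnd a r ⌊2 * Q⌋₊ : ℕ) : ℝ) / (((r * ∏ p ∈ U ∪ S, p).totient : ℝ) * Real.log 2) + 2 ^ (10 : ℕ)) +
          2 + 1 := by
    intro r hr; rw [hempty] at hr; exact absurd hr (notMem_empty r)
  have hN10 : 0 < N + 1 := by linarith only [hN0]
  have hψ := pnt_all_columns hP1 haP hdPNT
    (by have := pnt_range (N := N + 1) hL1 hP1 hPle hyL f6; rwa [hQL] at this) hgood hXge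
  -- the rows
  have hq_gt : ∀ q ∈ moduliSet ⌊Q⌋₊ ⌊2 * Q⌋₊ (∏ p ∈ U ∪ S, p) a, Q < q ∧ L ≤ Real.log q ∧ (q : ℝ) ≤ 2 * Q := by
    intro q hq
    obtain ⟨⟨hq1, hq2⟩, -⟩ := mem_moduliSet.1 hq
    have h1 : (⌊Q⌋₊ : ℝ) + 1 ≤ q := by exact_mod_cast hq1
    have h2 : Q < q := by linarith only [h1, hQ₁lt]
    have h3 : (q : ℝ) ≤ (⌊2 * Q⌋₊ : ℕ) := by exact_mod_cast hq2
    exact ⟨h2, by rw [← hLQ]; exact Real.log_le_log hQ0 h2.le, h3.trans hQ₂le⟩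
  have hyq : ∀ q ∈ moduliSet ⌊Q⌋₊ ⌊2 * Q⌋₊ (∏ p ∈ U ∪ S, p) a,
      (q : ℝ) * Real.log q ^ N ≤ (a : ℝ) + ((⌊(L + Real.log 2) ^ N⌋₊ + 2 : ℕ) : ℝ) * q := by
    intro q hq
    obtain ⟨h1, h2, h3⟩ := hq_gt q hq
    have hq0 : (0 : ℝ) < q := hQ0.trans h1
    have e1 : Real.log q ≤ L + Real.log 2 := by
      calc Real.log q ≤ Real.log (2 * Q) := Real.log_le_log hq0 h3
        _ = L + Real.log 2 := by rw [Real.log_mul two_ne_zero hQ0.ne', hLQ]; ring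
    have e2 : Real.log q ^ N ≤ (L + Real.log 2) ^ N := Real.rpow_le_rpow (by linarith only [hL0, h2]) e1 hN0.le
    have e3 : (q : ℝ) * Real.log q ^ N ≤ q * ((((⌊(L + Real.log 2) ^ N⌋₊ + 2 : ℕ)) : ℝ) - 1) :=
      mul_le_mul_of_nonneg_left (by linarith only [e2, hy_gt]) hq0.le
    nlinarith only [e3, haQ'.1, h1]
  have hπlow : ∀ x : ℝ, x₀ ≤ x → (1 - ε) * (x / Real.log x) ≤ (Nat.primeCounting ⌊x⌋₊ : ℝ) := by
    intro x hx; have := (abs_le.1 (hx₀ x hx)).1; linarith only [this]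
  obtain ⟨Dn, hDn⟩ : ∃ Dn : ℝ, Dn = L + Real.log 2 + N * Real.log (L + Real.log 2) := ⟨_, rfl⟩
  have hDn0 : 0 < Dn := by
    rw [hDn]; have : 0 ≤ Real.log (L + Real.log 2) := Real.log_nonneg (by linarith only [hL1, hlog2]); positivity
  have hLam : ∀ q ∈ moduliSet ⌊Q⌋₊ ⌊2 * Q⌋₊ (∏ p ∈ U ∪ S, p) a,
      (1 - ε) * L ^ N / Dn ≤ (Nat.primeCounting ⌊(q : ℝ) * Real.log q ^ N⌋₊ : ℝ) / q := by
    intro q hq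
    obtain ⟨h1, -, h3⟩ := hq_gt q hq
    rw [hDn]
    exact Lam_le_of hN0.le hε1 hL1 hQ0 hLQ h1 h3 g6 hπlow
  -- ### smallness `ht1`, `ht2`
  have hlogX : Real.log (Q / L ^ 2) ≤ Real.log ((⌈Q / L ^ 2⌉₊ : ℕ) : ℝ) := Real.log_le_log (by positivity) hXge
  have hlogQL : Real.log (Q / L ^ 2) = L - 2 * Real.log L := by
    rw [Real.log_div hQ0.ne' (by positivity), hLQ, Real.log_pow]; ring
  have hXpos : (0 : ℝ) < ((⌈Q / L ^ 2⌉₊ : ℕ) : ℝ) := by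
    have : (2 : ℝ) ≤ ⌈Q / L ^ 2⌉₊ := le_trans g4 hXge
    linarith only [this]
  have hlogXle : Real.log ((⌈Q / L ^ 2⌉₊ : ℕ) : ℝ) ≤ L := by
    calc Real.log ((⌈Q / L ^ 2⌉₊ : ℕ) : ℝ) ≤ Real.log Q := Real.log_le_log hXpos (by linarith only [hXlt, g5])
      _ = L := hLQ
  have hlogXge : L / 2 ≤ Real.log ((⌈Q / L ^ 2⌉₊ : ℕ) : ℝ) := by linarith only [hlogX, hlogQL, g10]
  have hlogX0 : 0 < Real.log ((⌈Q / L ^ 2⌉₊ : ℕ) : ℝ) := by linarith only [hlogXge, hL0]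
  have hLam0 : 0 ≤ (1 - ε) * L ^ N / Dn := by
    have : 0 ≤ 1 - ε := by linarith only [hε1]
    positivity
  have ht1 : (1 - η / 100) * (((⌊(L + Real.log 2) ^ N⌋₊ + 2 : ℕ)) : ℝ) ≤
      (1 - ε) * L ^ N / Dn * Real.log ((⌈Q / L ^ 2⌉₊ : ℕ) : ℝ) := by
    have e1 : (1 - η / 100) * (((⌊(L + Real.log 2) ^ N⌋₊ + 2 : ℕ)) : ℝ) ≤ (1 - η / 100) * ((L + Real.log 2) ^ N + 2) :=
      mul_le_mul_of_nonneg_left hy_le (by linarith only [hη1])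
    have e2 : (1 - η / 100) * ((L + Real.log 2) ^ N + 2) ≤ (1 - ε) * L ^ N / Dn * (L - 2 * Real.log L) := by
      rw [div_mul_eq_mul_div, le_div_iff₀ hDn0, hεdef]; rw [hDn]; linarith only [ft1]
    have e3 : (1 - ε) * L ^ N / Dn * (L - 2 * Real.log L) ≤ (1 - ε) * L ^ N / Dn * Real.log ((⌈Q / L ^ 2⌉₊ : ℕ) : ℝ) :=
      mul_le_mul_of_nonneg_left (by linarith only [hlogX, hlogQL]) hLam0
    linarith only [e1, e2, e3]
  have ht2 : 100 ≤ η * ((1 - η / 20) * ((1 - ε) * L ^ N / Dn)) := by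
    have e : η * ((1 - η / 20) * ((1 - ε) * L ^ N / Dn)) = η * ((1 - η / 20) * ((1 - ε) * L ^ N)) / Dn := by ring
    rw [e, le_div_iff₀ hDn0, hεdef]; rw [hDn]; linarith only [ft2]
  -- ### smallness `ht3`
  have hΔ : Q - 1 ≤ ((⌊2 * Q⌋₊ : ℕ) : ℝ) - (⌊Q⌋₊ : ℕ) := by linarith only [hQ₁le, hQ₂lt]
  have hΔ' : ((⌊2 * Q⌋₊ : ℕ) : ℝ) - (⌊Q⌋₊ : ℕ) ≤ Q + 1 := by linarith only [hQ₁lt, hQ₂le]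
  have hF4pos : (0 : ℝ) < (4 : ℝ) ^ (L ^ b' + 1) := Real.rpow_pos_of_pos (by norm_num) _
  have hΔP : (Q - 1) / (4 : ℝ) ^ (L ^ b' + 1) ≤ (((⌊2 * Q⌋₊ : ℕ) : ℝ) - (⌊Q⌋₊ : ℕ)) / (∏ p ∈ U ∪ S, p : ℕ) :=
    div_le_div₀ (by linarith only [hΔ, hQ16]) hΔ hP0R hPle
  have hΔP' : (Q - 1) / (∏ p ∈ U ∪ S, p : ℕ) ≤ (((⌊2 * Q⌋₊ : ℕ) : ℝ) - (⌊Q⌋₊ : ℕ)) / (∏ p ∈ U ∪ S, p : ℕ) :=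
    div_le_div_of_nonneg_right hΔ hP0R.le
  have hM0 : 0 ≤ (((⌊2 * Q⌋₊ : ℕ) : ℝ) - (⌊Q⌋₊ : ℕ)) / (∏ p ∈ U ∪ S, p : ℕ) := by
    have : 0 ≤ ((⌊2 * Q⌋₊ : ℕ) : ℝ) - (⌊Q⌋₊ : ℕ) := by linarith only [hΔ, hQ16]
    positivity
  have hlogzv0 : 0 < Real.log ((⌊L ^ (2 * γ)⌋₊ : ℝ) + 1) := Real.log_pos (by linarith only [hz])
  have hlogzv : Real.log ((⌊L ^ (2 * γ)⌋₊ : ℝ) + 1) ≤ 3 * γ * Real.log L := by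
    calc Real.log ((⌊L ^ (2 * γ)⌋₊ : ℝ) + 1) ≤ Real.log (L ^ (3 * γ)) :=
          Real.log_le_log (by linarith only [hz]) (by linarith only [hzv3γ])
      _ = 3 * γ * Real.log L := Real.log_rpow hL0 _
  have h4a : C_F * Real.exp (-(Real.log (Real.exp (L / 2)) / Real.log ((⌊L ^ (2 * γ)⌋₊ : ℝ) + 1))) ≤ η / 400 := by
    refine le_trans (mul_le_mul_of_nonneg_left ?_ hC_F0.le) f12
    rw [Real.log_exp, Real.exp_le_exp, neg_le_neg_iff]
    exact div_le_div_of_nonneg_left (by positivity) hlogzv0 hlogzv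
  have hkey4 : ∀ (Z cst : ℝ), 0 < cst → cst * V₁c * Real.log L * Z * (4 : ℝ) ^ (L ^ b' + 1) ≤ η * (Q - 1) →
      Z ≤ η / cst * ((((⌊2 * Q⌋₊ : ℕ) : ℝ) - (⌊Q⌋₊ : ℕ)) / (∏ p ∈ U ∪ S, p : ℕ) * (V₁c * Real.log L)⁻¹) := by
    intro Z cst hcst hZ
    have e1 : Z ≤ η / cst * ((Q - 1) / (4 : ℝ) ^ (L ^ b' + 1)) * (V₁c * Real.log L)⁻¹ := by
      have : η / cst * ((Q - 1) / (4 : ℝ) ^ (L ^ b' + 1)) * (V₁c * Real.log L)⁻¹ =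
          η * (Q - 1) / (cst * V₁c * Real.log L * (4 : ℝ) ^ (L ^ b' + 1)) := by field_simp
      rw [this, le_div_iff₀ (by positivity)]; linarith only [hZ]
    have e2 : η / cst * ((Q - 1) / (4 : ℝ) ^ (L ^ b' + 1)) * (V₁c * Real.log L)⁻¹ ≤
        η / cst * ((((⌊2 * Q⌋₊ : ℕ) : ℝ) - (⌊Q⌋₊ : ℕ)) / (∏ p ∈ U ∪ S, p : ℕ) * (V₁c * Real.log L)⁻¹) := by
      rw [mul_assoc]; exact mul_le_mul_of_nonneg_left (mul_le_mul_of_nonneg_right hΔP hV₁pos.le) (by positivity)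
    exact e1.trans e2
  have hkey4' : ∀ (Z cst : ℝ), 0 < cst → cst * V₁c * Real.log L * Z * (4 : ℝ) ^ (L ^ b' + 1) ≤ η * (Q - 1) →
      Z ≤ η / cst * ((((⌊2 * Q⌋₊ : ℕ) : ℝ) - (⌊Q⌋₊ : ℕ)) / (∏ p ∈ U ∪ S, p : ℕ) * sieveDensity T) := by
    intro Z cst hcst hZ
    refine (hkey4 Z cst hcst hZ).trans ?_
    exact mul_le_mul_of_nonneg_left (mul_le_mul_of_nonneg_left hV₁T hM0) (by positivity)
  have h4b : Real.exp (L / 2) ≤ η / 400 * ((((⌊2 * Q⌋₊ : ℕ) : ℝ) - (⌊Q⌋₊ : ℕ)) / (∏ p ∈ U ∪ S, p : ℕ) * sieveDensity T) :=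
    hkey4' _ 400 (by norm_num) (by linarith only [f13])
  have hBvb : Q ^ (1 - 1 / Real.log L) ≤ η / 400 * ((((⌊2 * Q⌋₊ : ℕ) : ℝ) - (⌊Q⌋₊ : ℕ)) / (∏ p ∈ U ∪ S, p : ℕ) * sieveDensity T) := by
    have hBv : Q ^ (1 - 1 / Real.log L) = Real.exp (L - L / Real.log L) := by
      rw [Real.rpow_def_of_pos hQ0, hLQ]; congr 1; field_simp
    rw [hBv]
    exact hkey4' _ 400 (by norm_num) (by linarith only [fBv])
  have homb : (a.natAbs.primeFactors.card : ℝ) *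
      ((((⌊2 * Q⌋₊ : ℕ) : ℝ) - (⌊Q⌋₊ : ℕ)) / ((∏ p ∈ U ∪ S, p : ℕ) * L ^ (2 * γ)) + 1) ≤
        η / 400 * ((((⌊2 * Q⌋₊ : ℕ) : ℝ) - (⌊Q⌋₊ : ℕ)) / (∏ p ∈ U ∪ S, p : ℕ) * sieveDensity T) := by
    -- `L^γ/L^{2γ} ≤ (η/800) V₁`
    have hc20 : 0 < 20000 * V₁c * Real.log L := by positivity
    have e1 : L ^ γ / L ^ (2 * γ) ≤ η / 800 * (V₁c * Real.log L)⁻¹ := by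
      rw [div_le_iff₀ hwT0]
      have : η / 800 * (V₁c * Real.log L)⁻¹ * L ^ (2 * γ) = η * L ^ (2 * γ) / (800 * V₁c * Real.log L) := by field_simp
      rw [this, le_div_iff₀ (by positivity)]
      have hpos : 0 ≤ V₁c * Real.log L * L ^ γ := by positivity
      nlinarith only [f8, hpos]
    have e2 : (a.natAbs.primeFactors.card : ℝ) * ((((⌊2 * Q⌋₊ : ℕ) : ℝ) - (⌊Q⌋₊ : ℕ)) / ((∏ p ∈ U ∪ S, p : ℕ) * L ^ (2 * γ))) ≤
        η / 800 * ((((⌊2 * Q⌋₊ : ℕ) : ℝ) - (⌊Q⌋₊ : ℕ)) / (∏ p ∈ U ∪ S, p : ℕ) * sieveDensity T) := by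
      have f1 : (((⌊2 * Q⌋₊ : ℕ) : ℝ) - (⌊Q⌋₊ : ℕ)) / ((∏ p ∈ U ∪ S, p : ℕ) * L ^ (2 * γ)) =
          (((⌊2 * Q⌋₊ : ℕ) : ℝ) - (⌊Q⌋₊ : ℕ)) / (∏ p ∈ U ∪ S, p : ℕ) * (L ^ (2 * γ))⁻¹ := by
        rw [div_mul_eq_div_div, div_eq_mul_inv]
      rw [f1]
      calc (a.natAbs.primeFactors.card : ℝ) * ((((⌊2 * Q⌋₊ : ℕ) : ℝ) - (⌊Q⌋₊ : ℕ)) / (∏ p ∈ U ∪ S, p : ℕ) * (L ^ (2 * γ))⁻¹)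
          = (((⌊2 * Q⌋₊ : ℕ) : ℝ) - (⌊Q⌋₊ : ℕ)) / (∏ p ∈ U ∪ S, p : ℕ) * ((a.natAbs.primeFactors.card : ℝ) / L ^ (2 * γ)) := by
            ring
        _ ≤ (((⌊2 * Q⌋₊ : ℕ) : ℝ) - (⌊Q⌋₊ : ℕ)) / (∏ p ∈ U ∪ S, p : ℕ) * (η / 800 * (V₁c * Real.log L)⁻¹) := by
            refine mul_le_mul_of_nonneg_left ?_ hM0
            exact (div_le_div_of_nonneg_right hωR hwT0.le).trans e1
        _ ≤ (((⌊2 * Q⌋₊ : ℕ) : ℝ) - (⌊Q⌋₊ : ℕ)) / (∏ p ∈ U ∪ S, p : ℕ) * (η / 800 * sieveDensity T) :=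
            mul_le_mul_of_nonneg_left (mul_le_mul_of_nonneg_left hV₁T (by positivity)) hM0
        _ = η / 800 * ((((⌊2 * Q⌋₊ : ℕ) : ℝ) - (⌊Q⌋₊ : ℕ)) / (∏ p ∈ U ∪ S, p : ℕ) * sieveDensity T) := by ring
    have e3 : (a.natAbs.primeFactors.card : ℝ) * 1 ≤
        η / 800 * ((((⌊2 * Q⌋₊ : ℕ) : ℝ) - (⌊Q⌋₊ : ℕ)) / (∏ p ∈ U ∪ S, p : ℕ) * sieveDensity T) := by
      rw [mul_one]
      exact hωR.trans (hkey4' _ 800 (by norm_num) (by linarith only [fom]))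
    rw [mul_add]
    linarith only [e2, e3]
  have ht3 := ht3_of (M := (((⌊2 * Q⌋₊ : ℕ) : ℝ) - (⌊Q⌋₊ : ℕ)) / (∏ p ∈ U ∪ S, p : ℕ)) (V_T := sieveDensity T)
    (mul_nonneg hM0 (hV₁pos.le.trans hV₁T)) hBvb homb h4a h4b
  -- ### smallness `ht4`
  have ht4 : ε * (3 * (⌊Q⌋₊ : ℕ) + (⌊2 * Q⌋₊ : ℕ)) ≤ η / 100 * (((⌊2 * Q⌋₊ : ℕ) : ℝ) - (⌊Q⌋₊ : ℕ)) := by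
    have e1 : ε * (3 * (⌊Q⌋₊ : ℕ) + (⌊2 * Q⌋₊ : ℕ)) ≤ ε * (5 * Q) :=
      mul_le_mul_of_nonneg_left (by linarith only [hQ₁le, hQ₂le]) hε0.le
    have e2 : η / 100 * (Q - 1) ≤ η / 100 * (((⌊2 * Q⌋₊ : ℕ) : ℝ) - (⌊Q⌋₊ : ℕ)) :=
      mul_le_mul_of_nonneg_left hΔ (by positivity)
    have e3 : 16 * η ≤ Q * η := mul_le_mul_of_nonneg_right hQ16 hη0.le
    rw [hεdef] at e1 ⊢
    linarith only [e1, e2, e3, hη0]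
  -- ### smallness `ht6` (and `ErrB ≤ yVW`)
  have hEx : Real.exp (-(Real.log (L ^ θ₁) / Real.log ((⌊L ^ (2 * γ)⌋₊ : ℝ) + 1))) ≤ Real.exp (-(θ₁ / (3 * γ))) := by
    rw [Real.exp_le_exp, neg_le_neg_iff, Real.log_rpow hL0]
    calc θ₁ / (3 * γ) = θ₁ * Real.log L / (3 * γ * Real.log L) := by field_simp
      _ ≤ θ₁ * Real.log L / Real.log ((⌊L ^ (2 * γ)⌋₊ : ℝ) + 1) :=
          div_le_div_of_nonneg_left (by positivity) hlogzv0 hlogzv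
  have hPi0 : 0 ≤ ∏ p ∈ S, (1 + (p : ℝ)⁻¹) := prod_nonneg fun p _ ↦ by positivity
  have hPi : ∏ p ∈ S, (1 + (p : ℝ)⁻¹) ≤ Real.exp 1 := (prod_one_add_inv_le_exp S).trans (Real.exp_le_exp.2 hSsum)
  have hA80 : 80000 * V₁c ≤ η * (80000 * V₁c / η) := by rw [mul_div_cancel₀ _ hη0.ne']
  obtain ⟨hT2, -, -⟩ := hs1_terms (K := 0) (A := 80000 * V₁c / η) (cS := (#S : ℝ))
    (om := (a.natAbs.primeFactors.card : ℝ)) (y := (((⌊(L + Real.log 2) ^ N⌋₊ + 2 : ℕ)) : ℝ)) hL0 hη0 hV₁c0 hlogL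
    (by positivity) (Nat.cast_nonneg _) hScardR f7 hωR f8 hy0 hA80 (Or.inl rfl)
  have hem : Real.exp (((⌊C₀ * Real.log L⌋₊ : ℕ) : ℝ)⁻¹) - 1 ≤ η / 1000 * (V₁c * Real.log L)⁻¹ := by
    have e1 := exp_inv_sub_one_le hm₀1
    have hm₀ge : C₀ * Real.log L / 2 ≤ (⌊C₀ * Real.log L⌋₊ : ℕ) := by
      have : C₀ * Real.log L < (⌊C₀ * Real.log L⌋₊ : ℕ) + 1 := Nat.lt_floor_add_one _
      linarith only [this, f4a]
    have hm₀pos : (0 : ℝ) < (⌊C₀ * Real.log L⌋₊ : ℕ) := by exact_mod_cast hm₀1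
    have e2 : 2 * ((⌊C₀ * Real.log L⌋₊ : ℕ) : ℝ)⁻¹ ≤ 4 / (C₀ * Real.log L) := by
      rw [← div_eq_mul_inv, div_le_div_iff₀ hm₀pos (by positivity)]; linarith only [hm₀ge]
    have h4000 : 4000 * V₁c ≤ η * C₀ := by
      rw [hV₁c, hηC₀]; linarith only [mul_pos hγ0 he50, hη0]
    have e3 : 4 / (C₀ * Real.log L) ≤ η / 1000 * (V₁c * Real.log L)⁻¹ := by
      have : η / 1000 * (V₁c * Real.log L)⁻¹ = η * C₀ / (1000 * V₁c * (C₀ * Real.log L)) := by field_simp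
      rw [this, div_le_div_iff₀ (by positivity) (by positivity)]
      have hCL : 0 ≤ C₀ * Real.log L := by positivity
      calc 4 * (1000 * V₁c * (C₀ * Real.log L)) = 4000 * V₁c * (C₀ * Real.log L) := by ring
        _ ≤ η * C₀ * (C₀ * Real.log L) := mul_le_mul_of_nonneg_right h4000 hCL
    linarith only [e1, e2, e3]
  obtain ⟨ht6, hErrB⟩ := ht6_of (Sk := (k + 1) * ((#S : ℝ) + 1) ^ k * L ^ θ₁) hC_B0.le (Real.exp_pos _).le hEx hkeyB
    hPi0 hPi hy0 hyR hV₁pos.le hV₁V hW5 hη0.le hη1 hT2 hem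
  -- ### smallness `ht5`
  have h2y : (((⌊(L + Real.log 2) ^ N⌋₊ + 2 : ℕ)) : ℝ) * sieveDensity (T ∪ U) * sieveDensity S +
      (C_B * Real.exp (-(Real.log (L ^ θ₁) / Real.log ((⌊L ^ (2 * γ)⌋₊ : ℝ) + 1))) *
        (((⌊(L + Real.log 2) ^ N⌋₊ + 2 : ℕ)) : ℝ) * sieveDensity (T ∪ U) * ∏ p ∈ S, (1 + (p : ℝ)⁻¹) +
        (k + 1) * ((#S : ℝ) + 1) ^ k * L ^ θ₁) ≤ 2 * (((⌊(L + Real.log 2) ^ N⌋₊ + 2 : ℕ)) : ℝ) := by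
    have hV0 : 0 ≤ sieveDensity (T ∪ U) := hV₁pos.le.trans hV₁V
    have e1 : (((⌊(L + Real.log 2) ^ N⌋₊ + 2 : ℕ)) : ℝ) * sieveDensity (T ∪ U) * sieveDensity S ≤
        (((⌊(L + Real.log 2) ^ N⌋₊ + 2 : ℕ)) : ℝ) * 1 * 1 :=
      mul_le_mul (mul_le_mul_of_nonneg_left hVle1 hy0) hWle1 hW0 (by positivity)
    linarith only [e1, hErrB]
  have hcG0 : 0 ≤ ((⌈Q / L ^ 2⌉₊ : ℕ) : ℝ) / (∏ p ∈ U ∪ S, p : ℕ) + 1 +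
      2 * Real.sqrt (3 * ((L + Real.log 2) ^ N + 2) * Q) * Real.log (3 * ((L + Real.log 2) ^ N + 2) * Q) /
        Real.log ((⌈Q / L ^ 2⌉₊ : ℕ) : ℝ) := by positivity
  have hcG : ((⌈Q / L ^ 2⌉₊ : ℕ) : ℝ) / (∏ p ∈ U ∪ S, p : ℕ) + 1 +
      2 * Real.sqrt (3 * ((L + Real.log 2) ^ N + 2) * Q) * Real.log (3 * ((L + Real.log 2) ^ N + 2) * Q) /
        Real.log ((⌈Q / L ^ 2⌉₊ : ℕ) : ℝ) ≤
      ((⌈Q / L ^ 2⌉₊ : ℕ) : ℝ) / (∏ p ∈ U ∪ S, p : ℕ) + 1 + 8 * Real.exp (5 * L / 8) := by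
    have e1 : 2 * Real.sqrt (3 * ((L + Real.log 2) ^ N + 2) * Q) * Real.log (3 * ((L + Real.log 2) ^ N + 2) * Q) ≤
        8 * Real.exp (5 * L / 8) * Real.log ((⌈Q / L ^ 2⌉₊ : ℕ) : ℝ) := by
      have f1 : 2 * Real.sqrt (3 * ((L + Real.log 2) ^ N + 2) * Q) * Real.log (3 * ((L + Real.log 2) ^ N + 2) * Q) ≤
          2 * Real.exp (5 * L / 8) * (2 * L) := mul_le_mul (by linarith only [hsqrtXmax]) hlogXmax2 hlX0 (by positivity)
      have f2 : 8 * Real.exp (5 * L / 8) * (L / 2) ≤ 8 * Real.exp (5 * L / 8) * Real.log ((⌈Q / L ^ 2⌉₊ : ℕ) : ℝ) :=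
        mul_le_mul_of_nonneg_left hlogXge (by positivity)
      linarith only [f1, f2]
    have e2 : 2 * Real.sqrt (3 * ((L + Real.log 2) ^ N + 2) * Q) * Real.log (3 * ((L + Real.log 2) ^ N + 2) * Q) /
        Real.log ((⌈Q / L ^ 2⌉₊ : ℕ) : ℝ) ≤ 8 * Real.exp (5 * L / 8) := by
      rw [div_le_iff₀ hlogX0]; exact e1
    linarith only [e2]
  -- `ρ = (η/300) V_T M / log X`
  have hρ : ∀ Z : ℝ, Z ≤ (((⌊2 * Q⌋₊ : ℕ) : ℝ) - (⌊Q⌋₊ : ℕ)) / (∏ p ∈ U ∪ S, p : ℕ) → 0 ≤ Z → ∀ cc : ℝ,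
      cc ≤ η / 300 * ((V₁c * Real.log L)⁻¹ * Z) / L →
        cc ≤ η / 300 * (sieveDensity T * ((((⌊2 * Q⌋₊ : ℕ) : ℝ) - (⌊Q⌋₊ : ℕ)) / (∏ p ∈ U ∪ S, p : ℕ)) /
          Real.log ((⌈Q / L ^ 2⌉₊ : ℕ) : ℝ)) := by
    intro Z hZ hZ0 cc hcc
    refine hcc.trans ?_
    have e1 : η / 300 * ((V₁c * Real.log L)⁻¹ * Z) ≤
        η / 300 * (sieveDensity T * ((((⌊2 * Q⌋₊ : ℕ) : ℝ) - (⌊Q⌋₊ : ℕ)) / (∏ p ∈ U ∪ S, p : ℕ))) :=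
      mul_le_mul_of_nonneg_left (mul_le_mul hV₁T hZ hZ0 (hV₁pos.le.trans hV₁T)) (by positivity)
    have hnum0 : 0 ≤ η / 300 * (sieveDensity T * ((((⌊2 * Q⌋₊ : ℕ) : ℝ) - (⌊Q⌋₊ : ℕ)) / (∏ p ∈ U ∪ S, p : ℕ))) := by
      have := hV₁pos.le.trans hV₁T; positivity
    calc η / 300 * ((V₁c * Real.log L)⁻¹ * Z) / L
        ≤ η / 300 * (sieveDensity T * ((((⌊2 * Q⌋₊ : ℕ) : ℝ) - (⌊Q⌋₊ : ℕ)) / (∏ p ∈ U ∪ S, p : ℕ))) / L :=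
          div_le_div_of_nonneg_right e1 hL0.le
      _ ≤ η / 300 * (sieveDensity T * ((((⌊2 * Q⌋₊ : ℕ) : ℝ) - (⌊Q⌋₊ : ℕ)) / (∏ p ∈ U ∪ S, p : ℕ))) /
          Real.log ((⌈Q / L ^ 2⌉₊ : ℕ) : ℝ) := div_le_div_of_nonneg_left hnum0 hlogX0 hlogXle
      _ = η / 300 * (sieveDensity T * ((((⌊2 * Q⌋₊ : ℕ) : ℝ) - (⌊Q⌋₊ : ℕ)) / (∏ p ∈ U ∪ S, p : ℕ)) /
          Real.log ((⌈Q / L ^ 2⌉₊ : ℕ) : ℝ)) := by ring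
  have hRy : 1 ≤ η / 300 * (sieveDensity T * ((((⌊2 * Q⌋₊ : ℕ) : ℝ) - (⌊Q⌋₊ : ℕ)) / (∏ p ∈ U ∪ S, p : ℕ)) /
      Real.log ((⌈Q / L ^ 2⌉₊ : ℕ) : ℝ)) := by
    refine hρ _ hΔP (div_nonneg (by linarith only [hQ16]) hF4pos.le) 1 ?_
    have : η / 300 * ((V₁c * Real.log L)⁻¹ * ((Q - 1) / (4 : ℝ) ^ (L ^ b' + 1))) / L =
        η * (Q - 1) / (300 * L * (V₁c * Real.log L) * (4 : ℝ) ^ (L ^ b' + 1)) := by field_simp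
    rw [this, le_div_iff₀ (by positivity)]; linarith only [fcolA]
  have hRX : 2 * (((⌈Q / L ^ 2⌉₊ : ℕ) : ℝ) / (∏ p ∈ U ∪ S, p : ℕ)) ≤
      η / 300 * (sieveDensity T * ((((⌊2 * Q⌋₊ : ℕ) : ℝ) - (⌊Q⌋₊ : ℕ)) / (∏ p ∈ U ∪ S, p : ℕ)) /
        Real.log ((⌈Q / L ^ 2⌉₊ : ℕ) : ℝ)) := by
    refine hρ _ hΔP' (div_nonneg (by linarith only [hQ16]) hP0R.le) _ ?_
    have e1 : 2 * (((⌈Q / L ^ 2⌉₊ : ℕ) : ℝ) / (∏ p ∈ U ∪ S, p : ℕ)) ≤ 2 * ((Q / L ^ 2 + 1) / (∏ p ∈ U ∪ S, p : ℕ)) :=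
      mul_le_mul_of_nonneg_left (div_le_div_of_nonneg_right hXlt.le hP0R.le) (by norm_num)
    have e2 : 2 * (Q / L ^ 2 + 1) ≤ η / 300 * ((V₁c * Real.log L)⁻¹ * (Q - 1)) / L := by
      have : η / 300 * ((V₁c * Real.log L)⁻¹ * (Q - 1)) / L = η * (Q - 1) / (300 * L * (V₁c * Real.log L)) := by
        field_simp
      rw [this, le_div_iff₀ (by positivity)]; linarith only [fcolB]
    have e3 : 2 * ((Q / L ^ 2 + 1) / (∏ p ∈ U ∪ S, p : ℕ)) ≤ η / 300 * ((V₁c * Real.log L)⁻¹ * ((Q - 1) / (∏ p ∈ U ∪ S, p : ℕ))) / L := by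
      have f1 := div_le_div_of_nonneg_right e2 hP0R.le
      have f2 : 2 * ((Q / L ^ 2 + 1) / (∏ p ∈ U ∪ S, p : ℕ)) = 2 * (Q / L ^ 2 + 1) / (∏ p ∈ U ∪ S, p : ℕ) := by ring
      have f3 : η / 300 * ((V₁c * Real.log L)⁻¹ * ((Q - 1) / (∏ p ∈ U ∪ S, p : ℕ))) / L =
          η / 300 * ((V₁c * Real.log L)⁻¹ * (Q - 1)) / L / (∏ p ∈ U ∪ S, p : ℕ) := by
        field_simp
      rw [f2, f3]; exact f1
    exact e1.trans e3
  have hRc : 2 * (1 + 8 * Real.exp (5 * L / 8)) ≤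
      η / 300 * (sieveDensity T * ((((⌊2 * Q⌋₊ : ℕ) : ℝ) - (⌊Q⌋₊ : ℕ)) / (∏ p ∈ U ∪ S, p : ℕ)) /
        Real.log ((⌈Q / L ^ 2⌉₊ : ℕ) : ℝ)) := by
    refine hρ _ hΔP (div_nonneg (by linarith only [hQ16]) hF4pos.le) _ ?_
    have : η / 300 * ((V₁c * Real.log L)⁻¹ * ((Q - 1) / (4 : ℝ) ^ (L ^ b' + 1))) / L =
        η * (Q - 1) / (300 * L * (V₁c * Real.log L) * (4 : ℝ) ^ (L ^ b' + 1)) := by field_simp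
    rw [this, le_div_iff₀ (by positivity)]; nlinarith only [fcolC]
  have ht5 := ht5_of (β := 0 * (((⌊Q⌋₊ : ℕ) : ℝ) + (⌊2 * Q⌋₊ : ℕ)) / ((((∏ p ∈ U ∪ S, p).totient : ℕ) : ℝ) * Real.log 2))
    (cB := 0 * (2 : ℝ) ^ (10 : ℕ) + 2 + 1) hy0 h2y hcG0 hcG hRy hRX hRc
  have ht5' : (((⌊(L + Real.log 2) ^ N⌋₊ + 2 : ℕ)) : ℝ) +
      ((((⌊(L + Real.log 2) ^ N⌋₊ + 2 : ℕ)) : ℝ) * sieveDensity (T ∪ U) * sieveDensity S +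
        (C_B * Real.exp (-(Real.log (L ^ θ₁) / Real.log ((⌊L ^ (2 * γ)⌋₊ : ℝ) + 1))) *
          (((⌊(L + Real.log 2) ^ N⌋₊ + 2 : ℕ)) : ℝ) * sieveDensity (T ∪ U) * ∏ p ∈ S, (1 + (p : ℝ)⁻¹) +
          (k + 1) * ((#S : ℝ) + 1) ^ k * L ^ θ₁)) *
        (((⌈Q / L ^ 2⌉₊ : ℕ) : ℝ) / (∏ p ∈ U ∪ S, p : ℕ) + 1 +
          2 * Real.sqrt (3 * ((L + Real.log 2) ^ N + 2) * Q) * Real.log (3 * ((L + Real.log 2) ^ N + 2) * Q) /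
            Real.log ((⌈Q / L ^ 2⌉₊ : ℕ) : ℝ)) +
      0 * (((⌊Q⌋₊ : ℕ) : ℝ) + (⌊2 * Q⌋₊ : ℕ)) / ((((∏ p ∈ U ∪ S, p).totient : ℕ) : ℝ) * Real.log 2) * 0 +
      (((⌊(L + Real.log 2) ^ N⌋₊ + 2 : ℕ)) : ℝ) / ((0 : ℕ) : ℝ) * (0 * (2 : ℝ) ^ (10 : ℕ) + 2 + 1) ≤
      η / 100 * ((((⌊(L + Real.log 2) ^ N⌋₊ + 2 : ℕ)) : ℝ) * sieveDensity T *
        ((((⌊2 * Q⌋₊ : ℕ) : ℝ) - (⌊Q⌋₊ : ℕ)) / (∏ p ∈ U ∪ S, p : ℕ)) / Real.log ((⌈Q / L ^ 2⌉₊ : ℕ) : ℝ)) := by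
    refine ht5.trans (le_of_eq ?_)
    ring
  -- ### the core, and the conclusion
  have hcore := core16_at hCB hCF (K := 0) (KBT := 0) (z_BT := 2) (Wbad := 0) hη0 hη1 hε0.le hε1 hC_F0.le hQ12 ha_natAbs
    ha0 hy1 hT hU hS hUa hSa hTz hUz hSz hw hSgt hyw hz hzD hkodd heS' hwT0 hout hz hTz hzTD hm₀1 hPs hPsm hPsP hfac
    hWbad hX2 hXQ hXmaxb hXmax2 le_rfl one_lt_two hψ hBT hyq hLam ht1 ht2 ht3 ht4 ht5' ht6
  refine hcore.trans ?_
  exact_mod_cast card_le_card fun q hq ↦ by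
    simp only [mem_filter] at hq ⊢
    obtain ⟨⟨hqD, hgcd⟩, hviol⟩ := hq
    obtain ⟨⟨hq1, hq2⟩, -⟩ := mem_moduliSet.1 hqD
    refine ⟨mem_Icc.2 ⟨by omega, hq2⟩, (hq_gt q hqD).1, hgcd, hviol⟩

set_option maxHeartbeats 2000000 in
/-- **(1.6) of the source, with all parameters fixed**: for `N > 2` there are `γ, δ, Q₀ > 0` such
that for `Q > Q₀` and `a ≠ 0`, `|a| ≤ Q`, `ω(a) < (log Q)^γ`, at least `Q^{1−1/log log Q}` moduli
`Q < q ≤ 2Q` coprime to `a` satisfy `π(q log^N q; q, a) < (1 − δ) π(q log^N q)/φ(q)`.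
[cite: FriedlanderGranville1992, Theorem p. 20, (1.6)] -/
theorem core16 {N : ℝ} (hN : 2 < N) :
    ∃ γ δ Q₀ : ℝ, 0 < γ ∧ 0 < δ ∧ 0 < Q₀ ∧
      ∀ Q : ℝ, Q₀ < Q → ∀ a : ℤ, a ≠ 0 → |(a : ℝ)| ≤ Q →
        ((ω a.natAbs : ℕ) : ℝ) < Real.log Q ^ γ →
          Q ^ (1 - 1 / Real.log (Real.log Q)) ≤
              (#((Icc 1 ⌊2 * Q⌋₊).filter fun q : ℕ =>
                  Q < (q : ℝ) ∧ Int.gcd (q : ℤ) a = 1 ∧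
                    (primeCountingModInt q a ((q : ℝ) * Real.log q ^ N) : ℝ) <
                      (1 - δ) * ((Nat.primeCounting ⌊(q : ℝ) * Real.log q ^ N⌋₊ : ℝ) /
                        (Nat.totient q : ℝ))) : ℝ) := by
  classical
  -- ### constants depending on `N`
  have hN0 : 0 < N := by linarith
  have hN1 : 1 ≤ N := by linarith
  set m : ℕ := ⌈N⌉₊ with hm
  have hmN : N ≤ m := Nat.le_ceil N
  set k : ℕ := 6 * m + 1 with hk
  have hkodd : Odd k := ⟨3 * m, by rw [hk]; ring⟩
  have hkR : (k : ℝ) = 6 * m + 1 := by rw [hk]; push_cast; ring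
  have hk5 : 5 * N < k + 1 := by rw [hkR]; linarith
  have hkpos : (0 : ℝ) < k := by rw [hkR]; linarith
  have hk1pos : (0 : ℝ) < k + 1 := by linarith
  set t : ℝ := N / (k + 1) with htdef
  have ht0 : 0 < t := div_pos hN0 hk1pos
  have ht5 : t < 1 / 5 := by rw [htdef, div_lt_iff₀ hk1pos]; linarith
  have htk : t < N / k := by rw [htdef]; exact div_lt_div_of_pos_left hN0 hkpos (by linarith)
  set g : ℝ := min (N / k - t) (1 / 5 - t) with hgdef
  have hg0 : 0 < g := lt_min (by linarith) (by linarith)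
  have hg1 : g ≤ N / k - t := min_le_left _ _
  have hg2 : g ≤ 1 / 5 - t := min_le_right _ _
  set c : ℝ := t + g / 4 with hcdef
  set b' : ℝ := t + g / 2 with hb'def
  have hc0 : 0 < c := by rw [hcdef]; positivity
  have hcb' : c < b' := by rw [hcdef, hb'def]; linarith
  have hb'5 : b' < 1 / 5 := by rw [hb'def]; linarith
  have hb'0 : 0 < b' := by linarith
  have hb'1 : b' < 1 := by linarith
  have hb'k : b' * k < N := by
    have : b' < N / k := by rw [hb'def]; linarith
    rwa [lt_div_iff₀ hkpos] at this
  have hck : N < c * (k + 1) := by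
    have : t < c := by rw [hcdef]; linarith
    have := mul_lt_mul_of_pos_right this hk1pos
    rwa [htdef, div_mul_cancel₀ _ hk1pos.ne'] at this
  set ℓ : ℝ := Real.log b' - Real.log c with hℓdef
  have hℓ0 : 0 < ℓ := by rw [hℓdef]; linarith [Real.log_lt_log hc0 hcb']
  have hℓ7 : ℓ < 7 / 10 := by
    have h2 : b' < 2 * c := by rw [hcdef, hb'def]; linarith
    have : Real.log b' < Real.log (2 * c) := Real.log_lt_log hb'0 h2
    rw [Real.log_mul two_ne_zero hc0.ne'] at this
    have hlog2 : Real.log 2 < 7 / 10 := by have := Real.log_two_lt_d9; linarith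
    rw [hℓdef]; linarith
  set η : ℝ := (ℓ / 2) ^ (k + 1) / (k + 1).factorial with hηdef
  have hη0 : 0 < η := by rw [hηdef]; positivity
  have hη1 : η ≤ 1 := by
    rw [hηdef, div_le_one (by exact_mod_cast (k + 1).factorial_pos)]
    calc (ℓ / 2) ^ (k + 1) ≤ 1 ^ (k + 1) := pow_le_pow_left₀ (by linarith) (by linarith) _
      _ = 1 := one_pow _
      _ ≤ (k + 1).factorial := by exact_mod_cast (k + 1).factorial_pos
  set ε : ℝ := η / 20000 with hεdef
  have hε0 : 0 < ε := by rw [hεdef]; positivity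
  set θ₁ : ℝ := (N - b' * k) / 2 with hθ₁def
  have hθ₁0 : 0 < θ₁ := by rw [hθ₁def]; linarith
  have hθ₁N : b' * k + θ₁ < N := by rw [hθ₁def]; linarith
  set R : ℕ := ⌈(N + 2) / c⌉₊ with hRdef
  have hRfact : N + 1 + b' < c * (R + 1) := by
    have h1 : (N + 2) / c ≤ R := Nat.le_ceil _
    have h2 : N + 2 ≤ c * R := by rw [div_le_iff₀ hc0] at h1; linarith
    nlinarith
  -- the sieve constants
  obtain ⟨C_B, hC_B0, hCB⟩ := shiftedSiftedCount_window_le_of_odd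
  obtain ⟨C_F, hC_F0, hCF⟩ := abs_apSiftedCount_sub_le
  set e5 : ℝ := Real.exp 5 with he5
  have he50 : 0 < e5 := Real.exp_pos 5
  set sstar : ℝ := max 1 (Real.log (20000 * Real.exp 1 * C_B / η)) with hsstar
  have hsstar1 : 1 ≤ sstar := le_max_left _ _
  have hsstar0 : 0 < sstar := by linarith
  set γ : ℝ := min (c / 6) (min (θ₁ / 4) (θ₁ / (4 * sstar))) with hγdef
  have hγ0 : 0 < γ := lt_min (by positivity) (lt_min (by positivity) (by positivity))
  have hγc : γ ≤ c / 6 := min_le_left _ _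
  have hγθ : γ ≤ θ₁ / 4 := (min_le_right _ _).trans (min_le_left _ _)
  have hγs : γ ≤ θ₁ / (4 * sstar) := (min_le_right _ _).trans (min_le_right _ _)
  have hγ1 : 2 * γ < 1 := by linarith
  set C₀ : ℝ := 20000 * γ * e5 / η + 2 with hC₀def
  have hC₀pos' : 0 ≤ 20000 * γ * e5 / η := by positivity
  have hC₀0 : 0 < C₀ := by rw [hC₀def]; linarith
  have hηC₀ : η * C₀ = 20000 * γ * e5 + 2 * η := by rw [hC₀def]; field_simp
  set A : ℝ := 2 * N + 2 * C₀ + 4 with hAdef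
  have hA0 : 0 < A := by rw [hAdef]; positivity
  set V₁c : ℝ := 3 * γ * e5 with hV₁c
  have hV₁c0 : 0 < V₁c := by positivity
  -- the analytic constants
  obtain ⟨x₀, hx₀⟩ := primeCounting_bounds hε0
  obtain ⟨XA₀, hXA₀⟩ := Literature.NumberTheory.LFunctions.PageUniformPNT.chebyshevPsiMod_uniform_conductor
    (b := 1 / 5) (by norm_num) (by norm_num) hε0 hA0
  have hkeyB : C_B * Real.exp (-(θ₁ / (3 * γ))) * Real.exp 1 ≤ η / 20000 := keyB_le hC_B0 hη0 hθ₁0 hγ0 hsstar hγs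
  -- ### the conditions on `L = log Q`
  have F1 : ∀ᶠ L : ℝ in atTop,
      |Literature.NumberTheory.LFunctions.Mertens.primeRecipSum (L ^ b') -
          Literature.NumberTheory.LFunctions.Mertens.primeRecipSum (L ^ c) - ℓ| ≤ ℓ / 8 :=
    Maier.eventually_abs_primeRecipSum_window hc0 hb'0 (by positivity)
  have F2 : ∀ᶠ L : ℝ in atTop, 2 * (k + 3) / ℓ ≤ L ^ c ∧ 16 / ℓ ≤ L ^ c ∧ 4 * k / ℓ ≤ L ^ c ∧ 1 ≤ L ^ c :=
    ((tendsto_rpow_atTop hc0).eventually_ge_atTop _).and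
      (((tendsto_rpow_atTop hc0).eventually_ge_atTop _).and
        (((tendsto_rpow_atTop hc0).eventually_ge_atTop _).and
          ((tendsto_rpow_atTop hc0).eventually_ge_atTop _)))
  have hγc' : γ < c := by linarith
  have F3 := facts_removed hγc' hc0 hℓ0 R
  have F4 := facts_sizes₁ hC₀0 hγ0 (show 2 * γ < c by linarith) (show 2 * γ < θ₁ by linarith) hγ1
  have F4' := facts_sizes₂ hN0 hmN hA0 hcb'.le XA₀ x₀
  have F10 : ∀ᶠ L : ℝ in atTop, 4 * Real.log L ≤ L ^ (1 : ℝ) := eventually_mul_log_le_rpow one_pos 4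
  have Fy := facts_y (k := k) hN0 hmN hck hRfact
  have F5 := facts_split₂ hN0 hC₀0 hAdef
  have F6 := facts_range (show 0 < N + 1 by linarith) hb'5
  have F7 := facts_windowErr (k := k) hb'0 hθ₁0 hθ₁N hV₁c0 hη0
  have F8 := facts_omega hγ0 hV₁c0 hη0
  have F12 := facts_rowFL hC_F0 hγ0 hη0
  have F13 := facts_Drow hb'1 hV₁c0 hη0
  have Ft1 := facts_t1 hN0 hη0 hη1
  have Ft2 := facts_t2 (show 1 < N by linarith) hη0 hη1
  have FA := facts_colA hb'1 hV₁c0 hη0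
  have FB := facts_colB hV₁c0 hη0
  have FC := facts_colC hb'1 hV₁c0 hη0
  have Fom := facts_om₂ (γ := γ) hb'1 hV₁c0 hη0
  have FBv := facts_Bv₂ hb'0.le hb'1 hV₁c0 hη0
  obtain ⟨L₀, hL₀⟩ := eventually_atTop.1 (F1.and (F2.and (F3.and (F4.and (F4'.and (F10.and (Fy.and (F5.and
    (F6.and (F7.and (F8.and (F12.and (F13.and (Ft1.and (Ft2.and (FA.and (FB.and (FC.and (Fom.and FBv)))))))))))))))))))
  refine ⟨γ, η / 20, Real.exp L₀, hγ0, by positivity, Real.exp_pos _, ?_⟩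
  intro Q hQ a ha0 haQ hω
  have hQ0 : 0 < Q := (Real.exp_pos _).trans hQ
  set L := Real.log Q with hLdef
  have hQL : Real.exp L = Q := Real.exp_log hQ0
  have hLL₀ : L₀ ≤ L := by rw [hLdef, Real.le_log_iff_exp_le hQ0]; exact hQ.le
  obtain ⟨f1, f2, f3, ⟨f4a, f4b, f4c, f4d, f4e, f4f⟩, ⟨-, -, ⟨g3, g4⟩, g5, g6, g7, g8, -⟩, g10, ⟨gy1, gy2, gy3, gy4⟩, f5,
    f6, f7, f8, f12, f13, ft1, ft2, fA, fB, fC, fom, fBv⟩ := hL₀ L hLL₀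
  rw [Real.rpow_one] at g10
  rw [hQL] at g3 g4 g5 g6 f13 fA fB fC fom fBv
  have hωR : (a.natAbs.primeFactors.card : ℝ) ≤ L ^ γ := by
    have : ((ω a.natAbs : ℕ) : ℝ) = a.natAbs.primeFactors.card := by
      rw [ArithmeticFunction.cardDistinctFactors_apply, ← List.card_toFinset]; rfl
    rw [← this]; exact hω.le
  exact core16_main hCB hCF hC_B0 hC_F0 hN hcb' hℓ0 hℓ7 hη0 hη1 hηdef hεdef hθ₁0 hγ0 hC₀0 hηC₀ hV₁c he5
    hkodd hkeyB hx₀ (hXA₀ (Q / L ^ 2) g3) f1 f2 f3 f4a f4b f4c f4d f4e f4f g4 g5 g6 g7 g8 g10 gy1 gy2 gy3 gy4 f5 f6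
    f7 f8 f12 f13 ft1 ft2 fA fB fC fom fBv hQ0 hQL ha0 haQ hωR

end Literature.Barriers.Parity.FriedlanderGranville

/-! ## The discharge -/

namespace Literature.Barriers.Parity

open FriedlanderGranville in
/-- **Friedlander–Granville, Theorem p. 20 of part III** — the named fact
`FriedlanderGranvilleUniformityBarrier` holds: both (1.5) (`core15`) and (1.6) (`core16`), with
`γ_N = min`, `δ_N = min`, `Q_N = max` of the two sets of constants (the counts are monotone in `δ`,
the hypothesis `ω(a) < (log Q)^γ` in `γ`). [cite: FriedlanderGranville1992, Theorem p. 20] -/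
theorem FriedlanderGranvilleUniformityBarrier_holds : FriedlanderGranvilleUniformityBarrier := by
  intro N hN
  obtain ⟨γ₁, δ₁, Q₁, hγ₁, hδ₁, hQ₁, h₁⟩ := core15 hN
  obtain ⟨γ₂, δ₂, Q₂, hγ₂, hδ₂, hQ₂, h₂⟩ := core16 hN
  refine ⟨min γ₁ γ₂, min δ₁ δ₂, max (max Q₁ Q₂) (Real.exp 1), lt_min hγ₁ hγ₂, lt_min hδ₁ hδ₂,
    lt_max_of_lt_left (lt_max_of_lt_left hQ₁), ?_⟩
  intro Q hQ a ha haQ hω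
  have hQ1 : Q₁ < Q := lt_of_le_of_lt ((le_max_left _ _).trans (le_max_left _ _)) hQ
  have hQ2 : Q₂ < Q := lt_of_le_of_lt ((le_max_right _ _).trans (le_max_left _ _)) hQ
  have hQe : Real.exp 1 < Q := lt_of_le_of_lt (le_max_right _ _) hQ
  have hlog1 : 1 ≤ Real.log Q := by
    rw [← Real.log_exp 1]; exact Real.log_le_log (Real.exp_pos 1) hQe.le
  have hω₁ : ((ω a.natAbs : ℕ) : ℝ) < Real.log Q ^ γ₁ :=
    hω.trans_le (Real.rpow_le_rpow_of_exponent_le hlog1 (min_le_left _ _))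
  have hω₂ : ((ω a.natAbs : ℕ) : ℝ) < Real.log Q ^ γ₂ :=
    hω.trans_le (Real.rpow_le_rpow_of_exponent_le hlog1 (min_le_right _ _))
  have k₁ := h₁ Q hQ1 a ha haQ hω₁
  have k₂ := h₂ Q hQ2 a ha haQ hω₂
  constructor
  · refine k₁.trans ?_
    exact_mod_cast card_le_card fun q hq ↦ by
      simp only [mem_filter] at hq ⊢
      obtain ⟨hq1, hq2, hq3, hq4⟩ := hq
      refine ⟨hq1, hq2, hq3, lt_of_le_of_lt ?_ hq4⟩
      exact mul_le_mul_of_nonneg_right (by linarith [min_le_left δ₁ δ₂]) (by positivity)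
  · refine k₂.trans ?_
    exact_mod_cast card_le_card fun q hq ↦ by
      simp only [mem_filter] at hq ⊢
      obtain ⟨hq1, hq2, hq3, hq4⟩ := hq
      refine ⟨hq1, hq2, hq3, lt_of_lt_of_le hq4 ?_⟩
      exact mul_le_mul_of_nonneg_right (by linarith [min_le_right δ₁ δ₂]) (by positivity)

end Literature.Barriers.Parity
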